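import Literature.NumberTheory.ConnesMoscovici2022.UVProlateSpectrum
import Literature.NumberTheory.ConnesMoscovici2022.UVProlateEigenfunctionEndpoint
import Literature.NumberTheory.ConnesMoscovici2022.UVProlateDeficiencyODE
import Mathlib.Analysis.ODE.Gronwall
import Mathlib.Analysis.InnerProductSpace.Calculus
import Mathlib.Analysis.SpecialFunctions.Integrability.Basic
import HarnessLib

/-!
# Connes–Moscovici 2022, Lemma 1.1 (deficiency indices `(4,4)`) — a-priori endpoint lemmas

LINE 1 — FRAMING. RH-FREE corpus literature (spectral theory of the prolate wave operator
`W_λ = −∂(λ² − x²)∂ + (2πλx)²` on `L²(ℝ)`; sequel row of the Connes–Consani corpus, no leaf / binder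
role).  bears_on: LADDER-RH W-C/W-P.  WHAT THIS IS NOT: any claim about RH; nothing in this file
mentions `RiemannHypothesis` or bears on the truth of RH.

Theorems-only companion of `UVProlateSpectrum.lean` and of `UVProlateDeficiencyODE.lean` (part A of the
discharge of the named fact `CM22_lemma_1_1`, **Lemma 1.1** of A. Connes, H. Moscovici, *The UV prolate
spectrum matches the zeros of zeta*, PNAS 119 (2022) [bib: `ConnesMoscovici2022`] = arXiv:2112.05500
Lemma 2.1, chunk p0004:L39–L48: "The deficiency indices of `W_min` are `(4,4)`. … since all `4` singular
points are LC (limit circle case), any solution of `Wξ = ±iξ` belongs to `Dom(W_max)`").  This file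
supplies the three A-PRIORI estimates behind "limit circle" and "belongs to `Dom(W_max)`", with NO
boundary condition assumed (unlike `exists_tendsto_nhdsGT_of_singular_endpoint` of
`UVProlateEigenfunctionEndpoint.lean`, which assumes `(λ² − x²)∂ξ → 0`):

* `singularEndpoint_right` — at a REGULAR SINGULAR endpoint `a` of `(P g′)′ = r g` on `(a,b)` with
  `‖r‖ ≤ Q` and `‖P(x)‖ ≥ m(x − a)`: `P g′` has a limit at `a⁺`, `(x − a)g(x) → 0`, and `g ∈ L²(a,b)`
  (so every classical solution near `±λ` is square integrable with at most a logarithmic singularity: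
  the limit-circle case);
* `singularEndpoint_left` — the mirror statement at `b⁻` (`‖P(x)‖ ≥ m(b − x)`), by the reflection
  `x ↦ a + b − x`;
* `prolate_decay_atTop` — at the IRREGULAR singular point `+∞` of the prolate equation
  `((λ² − x²) g′)′ = ((2πλx)² − z) g` (`z ∈ ℂ` arbitrary): `g, g′ = O(1/x)` on `x > max(2λ, 1)`
  (and `g ∈ L²` at `+∞`).

## Proofs

* Right endpoint: the energy `E = ‖P g′‖² + (x − a)‖g‖²` satisfies `E′ ≥ −(Q + 1/m)² E` on `(a,b)`
  (the term `+‖g‖²` of `E′` has the good sign when integrating BACKWARDS; AM–GM), so `E e^{Kx}` is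
  monotone and `P g′` is bounded by `B` on `(a, x₀]`; hence `‖g′‖ ≤ B/(m(x−a))`,
  `‖g(x) − g(x₀)‖ ≤ (B/m) log((x₀−a)/(x−a)) ≤ (4B/m)((x₀−a)/(x−a))^{1/4}` (boundary-comparison lemma
  `image_norm_le_of_norm_deriv_right_le_deriv_boundary'`, then `log y ≤ 4 y^{1/4}`), which gives
  `(x−a)g → 0`, `‖g‖² ≲ (x−a)^{−1/2} ∈ L¹`, `r g ∈ L¹` and the limit of `P g′ = P g′(x₀) − ∫ r g`;
  on `[x₀, b)` the pair `(g, P g′)` obeys a linear system with bounded coefficients (Grönwall,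
  `norm_le_gronwallBound_of_norm_deriv_right_le`).
* `+∞`: with `v = x g` one has `(λ² − x²)(v″ + ω² v) = 2λ² g′ + (ω²λ² − z) v` (`ω = 2πλ`), so
  `‖v″ + ω²v‖ ≤ (K/x²)(‖v‖ + ‖v′‖)` for `x > max(2λ,1)`; the energy `Φ = ω²‖v‖² + ‖v′‖²` has
  `Φ′ = 2 Re⟨v′, v″ + ω²v⟩ ≤ (K′/x²) Φ`, so `Φ e^{K′/x}` is antitone and `v, v′` are bounded
  (the road of `UVProlateEigenfunctionAsymptotics.prolate_v_identity`, redone for complex `z`).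

Append No. 1 (§4–§5, the inputs of the COUNT in part C): `exists_tendsto_of_singularEndpoint_right/left`
(when the logarithmic coefficient `lim P g′` vanishes, `g` itself has a finite limit — the a-priori
`L²`/`C¹` hypotheses of `exists_tendsto_nhdsGT_of_singular_endpoint` being now discharged),
`wronskian_tendsto_zero_of_tendsto_zero[_left]` (two solutions with vanishing logarithmic coefficients
have Wronskian `→ 0`, hence `≡ 0`: the limit functional `g ↦ lim p g′` is non-zero on the solution
space), and the `x ↦ −x` mirrors `prolate_decay_atBot`, `prolate_sq_integrableOn_Iio` of §3; §6 specialises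
to the prolate equation at `λ⁺` / `(−λ)⁻` (`prolate_singularEndpoint_right/left`: `m = 2λ`,
`Q = (2πλ)²(λ+1)² + ‖z‖` on `(λ, λ+1)`) and proves the NON-DEGENERACY OF THE LIMIT FUNCTIONAL:
`exists_sol_Ioi_tendsto_ne_zero` / `exists_sol_Iio_tendsto_ne_zero` — on `(λ, ∞)` (resp. `(−∞, −λ)`)
there is a classical solution with `lim p g′ ≠ 0` at the singular point (two solutions with Wronskian
`1` at `x₀`, `UVProlateDeficiencyODE.exists_sol_Ioi` + `wronskian_sol_eq`, cannot both have vanishing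
logarithmic coefficient).  Append No. 2 (§7) does the same for the MIDDLE component `(−λ, λ)` at
its two singular endpoints `λ⁻` and `(−λ)⁺` (`prolate_singularEndpoint_mid_right/left`, `m = λ`,
`Q = (2πλ)²λ² + ‖z‖`, `prolate_sq_integrableOn_mid`, `exists_sol_Ioo_tendsto_ne_zero_right/left`), so that
all four regular-singular endpoint-sides and `±∞` are covered ("all 4 singular points are LC");
§8 packages the full-component statements `prolate_sq_integrableOn_Ioi_lam` / `_Iio_neg_lam`
(`g ∈ L²(λ, ∞)`, `g ∈ L²(−∞, −λ)` for every classical solution pair) used to put a glued solution in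
`L²(ℝ)`.

References: [ConnesMoscovici2022, Lemma 1.1 (= arXiv:2112.05500 Lemma 2.1, chunk p0004:L39–L48)];
regular singular points / limit-circle bookkeeping: [CoddingtonLevinson1955, Ch. 9 §2–§4];
[Hartman2002, Ch. XI §1].  0 `def`s, 0 new facts, no `sorry`.
-/

noncomputable section

open Complex Set MeasureTheory Filter Topology intervalIntegral
open scoped Real Topology InnerProductSpace

namespace Literature.NumberTheory.ConnesMoscovici2022

/-! ## §1 Elementary lemmas -/

section Elementary

/-- `log y ≤ 4 · y^{1/4}` in square-root form (`y ≥ 0`). [folklore] -/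
private theorem log_le_four_mul_sqrt_sqrt {y : ℝ} (hy : 0 ≤ y) :
    Real.log y ≤ 4 * Real.sqrt (Real.sqrt y) := by
  rcases hy.eq_or_lt with h | h
  · rw [← h]; simp
  · have h1 : Real.log y = 4 * Real.log (Real.sqrt (Real.sqrt y)) := by
      rw [Real.log_sqrt (Real.sqrt_nonneg _), Real.log_sqrt h.le]; ring
    have h2 : 0 < Real.sqrt (Real.sqrt y) := Real.sqrt_pos.2 (Real.sqrt_pos.2 h)
    rw [h1]
    have := Real.log_le_sub_one_of_pos h2
    linarith

/-- `t / √√t = √t · √√t` for `t ≥ 0`. [folklore] -/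
private theorem div_sqrt_sqrt_eq {t : ℝ} (ht : 0 ≤ t) :
    t / Real.sqrt (Real.sqrt t) = Real.sqrt t * Real.sqrt (Real.sqrt t) := by
  rcases ht.eq_or_lt with h | h
  · rw [← h]; simp
  · have h4 : 0 < Real.sqrt (Real.sqrt t) := Real.sqrt_pos.2 (Real.sqrt_pos.2 h)
    rw [div_eq_iff h4.ne']
    have hs : Real.sqrt (Real.sqrt t) * Real.sqrt (Real.sqrt t) = Real.sqrt t :=
      Real.mul_self_sqrt (Real.sqrt_nonneg _)
    calc t = Real.sqrt t * Real.sqrt t := (Real.mul_self_sqrt h.le).symm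
      _ = Real.sqrt t * Real.sqrt (Real.sqrt t) * Real.sqrt (Real.sqrt t) := by rw [mul_assoc, hs]

/-- `1/√√t ≤ 1 + 1/√t` for `t > 0`. [folklore] -/
private theorem inv_sqrt_sqrt_le {t : ℝ} (ht : 0 < t) :
    (Real.sqrt (Real.sqrt t))⁻¹ ≤ 1 + (Real.sqrt t)⁻¹ := by
  have hs : 0 < Real.sqrt t := Real.sqrt_pos.2 ht
  have hss : 0 < Real.sqrt (Real.sqrt t) := Real.sqrt_pos.2 hs
  rcases le_or_gt 1 t with h1 | h1
  · -- `t ≥ 1`: `√√t ≥ 1`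
    have : 1 ≤ Real.sqrt (Real.sqrt t) := by
      rw [show (1 : ℝ) = Real.sqrt (Real.sqrt 1) by simp]
      exact Real.sqrt_le_sqrt (Real.sqrt_le_sqrt h1)
    calc (Real.sqrt (Real.sqrt t))⁻¹ ≤ 1 := inv_le_one_of_one_le₀ this
      _ ≤ 1 + (Real.sqrt t)⁻¹ := le_add_of_nonneg_right (inv_nonneg.2 hs.le)
  · -- `t < 1`: `√t ≤ √√t`
    have hst : Real.sqrt t ≤ 1 := by
      rw [show (1 : ℝ) = Real.sqrt 1 by simp]; exact Real.sqrt_le_sqrt h1.le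
    have : Real.sqrt t ≤ Real.sqrt (Real.sqrt t) := by
      have h := Real.sqrt_le_sqrt (mul_le_of_le_one_left hs.le hst)
      rwa [Real.sqrt_mul_self hs.le] at h
    calc (Real.sqrt (Real.sqrt t))⁻¹ ≤ (Real.sqrt t)⁻¹ := inv_anti₀ hs this
      _ ≤ 1 + (Real.sqrt t)⁻¹ := le_add_of_nonneg_left zero_le_one

/-- **Logarithmic growth from a `1/(x−a)` derivative bound**: if `‖g′(x)‖ ≤ D/(x − a)` on `(a, x₀]`
then `‖g(x) − g(x₀)‖ ≤ D log((x₀ − a)/(x − a))` there (boundary-comparison lemma, no integration).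
[folklore] -/
private theorem norm_sub_le_mul_log {a x₀ D : ℝ} {g g' : ℝ → ℂ}
    (hg : ∀ x ∈ Ioc a x₀, HasDerivAt g (g' x) x) (hb : ∀ x ∈ Ioc a x₀, ‖g' x‖ ≤ D / (x - a))
    {x : ℝ} (hx : x ∈ Ioc a x₀) : ‖g x - g x₀‖ ≤ D * Real.log ((x₀ - a) / (x - a)) := by
  have hxa : 0 < x - a := sub_pos.2 hx.1
  have hx₀a : 0 < x₀ - a := hxa.trans_le (by linarith [hx.2])
  -- the reflected function `φ(s) = g(x₀ − s) − g(x₀)` on `[0, x₀ − x]`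
  set φ : ℝ → ℂ := fun s ↦ g (x₀ - s) - g x₀ with hφ
  have hmem : ∀ s ∈ Icc 0 (x₀ - x), x₀ - s ∈ Ioc a x₀ := fun s hs ↦
    ⟨by linarith [hs.2, hx.1], by linarith [hs.1]⟩
  have hφd : ∀ s ∈ Icc 0 (x₀ - x), HasDerivAt φ (-g' (x₀ - s)) s := by
    intro s hs
    have h := HasDerivAt.comp_const_sub x₀ s (hg (x₀ - s) (hmem s hs))
    exact h.sub_const (g x₀)
  have hφc : ContinuousOn φ (Icc 0 (x₀ - x)) := fun s hs ↦ (hφd s hs).continuousAt.continuousWithinAt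
  -- the comparison function `β(s) = D (log (x₀ − a) − log ((x₀ − a) − s))`
  set β : ℝ → ℝ := fun s ↦ D * (Real.log (x₀ - a) - Real.log ((x₀ - a) - s)) with hβ
  have hβd : ∀ s ∈ Icc 0 (x₀ - x), HasDerivAt β (D * ((x₀ - a) - s)⁻¹) s := by
    intro s hs
    have hne : (x₀ - a) - s ≠ 0 := by linarith [hs.2]
    have hl : HasDerivAt (fun s ↦ Real.log ((x₀ - a) - s)) (-((x₀ - a) - s)⁻¹) s :=
      HasDerivAt.comp_const_sub (x₀ - a) s (Real.hasDerivAt_log hne)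
    refine ((hl.const_sub (Real.log (x₀ - a))).const_mul D).congr_deriv ?_
    ring
  have hβc : ContinuousOn β (Icc 0 (x₀ - x)) := fun s hs ↦ (hβd s hs).continuousAt.continuousWithinAt
  have key := image_norm_le_of_norm_deriv_right_le_deriv_boundary' hφc
    (fun s hs ↦ (hφd s (Ico_subset_Icc_self hs)).hasDerivWithinAt)
    (B := β) (B' := fun s ↦ D * ((x₀ - a) - s)⁻¹) (by simp [hφ, hβ]) hβc
    (fun s hs ↦ (hβd s (Ico_subset_Icc_self hs)).hasDerivWithinAt)
    (fun s hs ↦ by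
      rw [norm_neg]
      have h := hb (x₀ - s) (hmem s (Ico_subset_Icc_self hs))
      rwa [show x₀ - s - a = (x₀ - a) - s by ring, div_eq_mul_inv] at h)
    (right_mem_Icc.2 (by linarith [hx.2]))
  have e1 : φ (x₀ - x) = g x - g x₀ := by simp [hφ]
  have e2 : β (x₀ - x) = D * Real.log ((x₀ - a) / (x - a)) := by
    simp only [hβ]
    rw [show (x₀ - a) - (x₀ - x) = x - a by ring, Real.log_div hx₀a.ne' hxa.ne']
  rwa [e1, e2] at key

end Elementary

/-! ## §2 The regular singular endpoint: energy bound, growth of `g`, and the three conclusions -/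

section SingularEndpoint

variable {a b m Q : ℝ} {g g' P r : ℝ → ℂ}

/-- **Backward energy estimate.**  For `(P g′)′ = r g` on `(a,b)` with `‖r‖ ≤ Q`, `‖P(x)‖ ≥ m(x − a)`,
the energy `E = ‖P g′‖² + (x − a)‖g‖²` satisfies `E′ ≥ −(Q + 1/m)² E`, so `E e^{Kx}` is monotone and
`P g′` is bounded on every `(a, x₀]`, `x₀ < b` — with NO boundary condition at `a`.
[cite: ConnesMoscovici2022, Lemma 1.1 (= arXiv:2112.05500 Lemma 2.1, chunk p0004:L39–L48)] -/
theorem exists_norm_mul_deriv_le_of_singularEndpoint (hm : 0 < m)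
    (hg : ∀ x ∈ Ioo a b, HasDerivAt g (g' x) x)
    (hu : ∀ x ∈ Ioo a b, HasDerivAt (fun y ↦ P y * g' y) (r x * g x) x)
    (hr : ∀ x ∈ Ioo a b, ‖r x‖ ≤ Q) (hp : ∀ x ∈ Ioo a b, m * (x - a) ≤ ‖P x‖)
    {x₀ : ℝ} (hx₀ : x₀ ∈ Ioo a b) :
    ∃ B : ℝ, 0 ≤ B ∧ ∀ x ∈ Ioc a x₀, ‖P x * g' x‖ ≤ B := by
  set w : ℝ → ℂ := fun y ↦ P y * g' y with hw
  have hQ0 : 0 ≤ Q := (norm_nonneg _).trans (hr x₀ hx₀)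
  set L : ℝ := Q + 1 / m with hL
  set K : ℝ := L ^ 2 with hK
  have hK0 : 0 ≤ K := sq_nonneg _
  set E : ℝ → ℝ := fun x ↦ ‖w x‖ ^ 2 + (x - a) * ‖g x‖ ^ 2 with hE
  set E' : ℝ → ℝ := fun x ↦
    2 * ⟪w x, r x * g x⟫_ℝ + (1 * ‖g x‖ ^ 2 + (x - a) * (2 * ⟪g x, g' x⟫_ℝ)) with hE'
  have hEd : ∀ x ∈ Ioo a b, HasDerivAt E (E' x) x := by
    intro x hx
    have h1 : HasDerivAt (fun y ↦ ‖w y‖ ^ 2) (2 * ⟪w x, r x * g x⟫_ℝ) x := (hu x hx).norm_sq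
    have h2 : HasDerivAt (fun y ↦ ‖g y‖ ^ 2) (2 * ⟪g x, g' x⟫_ℝ) x := (hg x hx).norm_sq
    have h3 : HasDerivAt (fun y : ℝ ↦ y - a) 1 x := (hasDerivAt_id x).sub_const a
    exact h1.add (h3.mul h2)
  -- the differential inequality `E′ ≥ −K E`
  have hineq : ∀ x ∈ Ioo a b, -K * E x ≤ E' x := by
    intro x hx
    have hxa : 0 < x - a := sub_pos.2 hx.1
    have hi1 : |⟪w x, r x * g x⟫_ℝ| ≤ ‖w x‖ * ‖r x * g x‖ := abs_real_inner_le_norm _ _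
    have hi2 : |⟪g x, g' x⟫_ℝ| ≤ ‖g x‖ * ‖g' x‖ := abs_real_inner_le_norm _ _
    have hrg : ‖r x * g x‖ ≤ Q * ‖g x‖ := by
      rw [norm_mul]; exact mul_le_mul_of_nonneg_right (hr x hx) (norm_nonneg _)
    -- `(x − a) ‖g′‖ ≤ ‖w‖ / m`
    have hg' : m * ((x - a) * ‖g' x‖) ≤ ‖w x‖ := by
      have h := mul_le_mul_of_nonneg_right (hp x hx) (norm_nonneg (g' x))
      rw [hw]; dsimp only; rw [norm_mul]
      linarith
    have hg'' : (x - a) * ‖g' x‖ ≤ ‖w x‖ / m := by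
      rw [le_div_iff₀ hm]; linarith
    have hA : -(2 * (‖w x‖ * (Q * ‖g x‖))) ≤ 2 * ⟪w x, r x * g x⟫_ℝ := by
      have := (abs_le.1 hi1).1
      nlinarith [norm_nonneg (w x), norm_nonneg (g x)]
    have hB : -(2 * (‖g x‖ * (‖w x‖ / m))) ≤ (x - a) * (2 * ⟪g x, g' x⟫_ℝ) := by
      have h := (abs_le.1 hi2).1
      have h' : (x - a) * (‖g x‖ * ‖g' x‖) ≤ ‖g x‖ * (‖w x‖ / m) := by
        have := mul_le_mul_of_nonneg_left hg'' (norm_nonneg (g x))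
        linarith [this]
      nlinarith
    have hEx : E x = ‖w x‖ ^ 2 + (x - a) * ‖g x‖ ^ 2 := rfl
    have hE'x : E' x = 2 * ⟪w x, r x * g x⟫_ℝ + (1 * ‖g x‖ ^ 2 + (x - a) * (2 * ⟪g x, g' x⟫_ℝ)) := rfl
    rw [hEx, hE'x]
    have hm' : 0 < 1 / m := by positivity
    have hkey : -(L ^ 2) * ‖w x‖ ^ 2 ≤ ‖g x‖ ^ 2 - 2 * L * (‖g x‖ * ‖w x‖) := by
      nlinarith [sq_nonneg (‖g x‖ - L * ‖w x‖)]
    have hsplit : 2 * L * (‖g x‖ * ‖w x‖) = 2 * (‖w x‖ * (Q * ‖g x‖)) + 2 * (‖g x‖ * (‖w x‖ / m)) := by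
      rw [hL]; ring
    have hpos : 0 ≤ (x - a) * ‖g x‖ ^ 2 := by positivity
    nlinarith
  -- `F = E · e^{Kx}` is monotone on `(a,b)`
  set F : ℝ → ℝ := fun x ↦ E x * Real.exp (K * x) with hF
  have hFd : ∀ x ∈ Ioo a b,
      HasDerivAt F (E' x * Real.exp (K * x) + E x * (Real.exp (K * x) * K)) x := by
    intro x hx
    have he : HasDerivAt (fun y ↦ Real.exp (K * y)) (Real.exp (K * x) * K) x := by
      have := ((hasDerivAt_id x).const_mul K).exp
      simpa using this
    exact (hEd x hx).mul he
  have hFmono : MonotoneOn F (Ioo a b) := by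
    refine monotoneOn_of_hasDerivWithinAt_nonneg (convex_Ioo a b)
      (f' := fun x ↦ E' x * Real.exp (K * x) + E x * (Real.exp (K * x) * K))
      (fun x hx ↦ (hFd x hx).continuousAt.continuousWithinAt) (fun x hx ↦ ?_) (fun x hx ↦ ?_)
    · rw [interior_Ioo] at hx ⊢; exact (hFd x hx).hasDerivWithinAt
    · rw [interior_Ioo] at hx
      have h := hineq x hx
      have hex : 0 < Real.exp (K * x) := Real.exp_pos _
      have : 0 ≤ (E' x + K * E x) * Real.exp (K * x) := mul_nonneg (by linarith) hex.le
      linarith [this]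
  -- the bound
  have hE0 : ∀ x ∈ Ioo a b, 0 ≤ E x := fun x hx ↦ by
    have : 0 ≤ (x - a) * ‖g x‖ ^ 2 := mul_nonneg (sub_pos.2 hx.1).le (sq_nonneg _)
    simp only [hE]; positivity
  set B : ℝ := Real.sqrt (E x₀ * Real.exp (K * (x₀ - a))) with hB
  refine ⟨B, Real.sqrt_nonneg _, fun x hx ↦ ?_⟩
  have hxb : x ∈ Ioo a b := ⟨hx.1, hx.2.trans_lt hx₀.2⟩
  have hFle : F x ≤ F x₀ := hFmono hxb hx₀ hx.2
  have h1 : E x ≤ E x₀ * Real.exp (K * (x₀ - a)) := by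
    have hex : 0 < Real.exp (K * x) := Real.exp_pos _
    have h2 : E x ≤ E x₀ * Real.exp (K * x₀) / Real.exp (K * x) := by
      rw [le_div_iff₀ hex]; exact hFle
    have h3 : E x₀ * Real.exp (K * x₀) / Real.exp (K * x) = E x₀ * Real.exp (K * (x₀ - x)) := by
      rw [mul_div_assoc, ← Real.exp_sub]; ring_nf
    rw [h3] at h2
    refine h2.trans (mul_le_mul_of_nonneg_left ?_ (hE0 x₀ hx₀))
    exact Real.exp_le_exp.2 (by nlinarith [hx.1])
  have h4 : ‖w x‖ ^ 2 ≤ E x := by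
    have : 0 ≤ (x - a) * ‖g x‖ ^ 2 := mul_nonneg (sub_pos.2 hx.1).le (sq_nonneg _)
    simp only [hE]; linarith
  calc ‖P x * g' x‖ = Real.sqrt (‖w x‖ ^ 2) := (Real.sqrt_sq (norm_nonneg _)).symm
    _ ≤ B := Real.sqrt_le_sqrt (h4.trans h1)

/-- **A-priori behaviour at a regular singular endpoint (right of `a`)** — the limit-circle
bookkeeping behind [ConnesMoscovici2022, Lemma 1.1]: let `g` solve `(P g′)′ = r g` on `(a,b)`
(pointwise `HasDerivAt` hypotheses, `g′` the derivative), with `r` continuous, `‖r‖ ≤ Q`, and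
`‖P(x)‖ ≥ m (x − a)` (`m > 0`; for the prolate operator `P = λ² − x²`, `a = λ` or `a = −λ`).  Then, with NO
boundary condition at `a`: (1) `P g′` has a limit at `a⁺`; (2) `(x − a) g(x) → 0` at `a⁺` (at most a
logarithmic singularity); (3) `g ∈ L²(a,b)`.
[cite: ConnesMoscovici2022, Lemma 1.1 (= arXiv:2112.05500 Lemma 2.1, chunk p0004:L39–L48)]
[cite: CoddingtonLevinson1955, Ch. 9 §2 and §4 (regular singular points; limit-circle case)] -/
theorem singularEndpoint_right (hab : a < b) (hm : 0 < m)
    (hg : ∀ x ∈ Ioo a b, HasDerivAt g (g' x) x)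
    (hu : ∀ x ∈ Ioo a b, HasDerivAt (fun y ↦ P y * g' y) (r x * g x) x)
    (hrc : ContinuousOn r (Ioo a b)) (hr : ∀ x ∈ Ioo a b, ‖r x‖ ≤ Q)
    (hp : ∀ x ∈ Ioo a b, m * (x - a) ≤ ‖P x‖) :
    (∃ c : ℂ, Tendsto (fun x ↦ P x * g' x) (𝓝[>] a) (𝓝 c)) ∧
      Tendsto (fun x ↦ ((x - a : ℝ) : ℂ) * g x) (𝓝[>] a) (𝓝 0) ∧
      IntegrableOn (fun x ↦ ‖g x‖ ^ 2) (Ioo a b) := by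
  set w : ℝ → ℂ := fun y ↦ P y * g' y with hw
  set x₀ : ℝ := (a + b) / 2 with hx₀_def
  have hx₀ : x₀ ∈ Ioo a b := ⟨left_lt_add_div_two.2 hab, add_div_two_lt_right.2 hab⟩
  have hQ0 : 0 ≤ Q := (norm_nonneg _).trans (hr x₀ hx₀)
  obtain ⟨B, hB0, hB⟩ := exists_norm_mul_deriv_le_of_singularEndpoint hm hg hu hr hp hx₀
  have hgc : ContinuousOn g (Ioo a b) := fun x hx ↦ (hg x hx).continuousAt.continuousWithinAt
  -- Step 1: `‖g′‖ ≤ D/(x − a)` on `(a, x₀]`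
  set D : ℝ := B / m with hD
  have hD0 : 0 ≤ D := div_nonneg hB0 hm.le
  have hderiv : ∀ x ∈ Ioc a x₀, ‖g' x‖ ≤ D / (x - a) := by
    intro x hx
    have hxb : x ∈ Ioo a b := ⟨hx.1, hx.2.trans_lt hx₀.2⟩
    have hxa : 0 < x - a := sub_pos.2 hx.1
    have h1 : m * (x - a) * ‖g' x‖ ≤ ‖P x‖ * ‖g' x‖ :=
      mul_le_mul_of_nonneg_right (hp x hxb) (norm_nonneg _)
    have h2 : ‖P x‖ * ‖g' x‖ ≤ B := by rw [← norm_mul]; exact hB x hx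
    rw [hD, div_div, le_div_iff₀ (mul_pos hm hxa)]
    linarith
  -- Step 2: growth `‖g x‖ ≤ A + C/√√(x − a)` on `(a, x₀]`
  set A : ℝ := ‖g x₀‖ with hA
  set C : ℝ := 4 * D * Real.sqrt (Real.sqrt (x₀ - a)) with hC_def
  have hC0 : 0 ≤ C := by positivity
  have hgrowth : ∀ x ∈ Ioc a x₀, ‖g x‖ ≤ A + C / Real.sqrt (Real.sqrt (x - a)) := by
    intro x hx
    have hxa : 0 < x - a := sub_pos.2 hx.1
    have h1 := norm_sub_le_mul_log (fun y hy ↦ hg y ⟨hy.1, hy.2.trans_lt hx₀.2⟩) hderiv hx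
    have h2 : Real.log ((x₀ - a) / (x - a)) ≤ 4 * Real.sqrt (Real.sqrt ((x₀ - a) / (x - a))) :=
      log_le_four_mul_sqrt_sqrt (div_nonneg (by linarith [hx.2]) hxa.le)
    have h3 : Real.sqrt (Real.sqrt ((x₀ - a) / (x - a))) =
        Real.sqrt (Real.sqrt (x₀ - a)) / Real.sqrt (Real.sqrt (x - a)) := by
      rw [Real.sqrt_div' _ hxa.le, Real.sqrt_div' _ (Real.sqrt_nonneg _)]
    rw [h3] at h2
    have h4 : ‖g x - g x₀‖ ≤ D * (4 * (Real.sqrt (Real.sqrt (x₀ - a)) / Real.sqrt (Real.sqrt (x - a)))) :=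
      h1.trans (mul_le_mul_of_nonneg_left h2 hD0)
    calc ‖g x‖ = ‖g x₀ + (g x - g x₀)‖ := by congr 1; ring
      _ ≤ ‖g x₀‖ + ‖g x - g x₀‖ := norm_add_le _ _
      _ ≤ A + D * (4 * (Real.sqrt (Real.sqrt (x₀ - a)) / Real.sqrt (Real.sqrt (x - a)))) := by
          rw [hA]; gcongr
      _ = A + C / Real.sqrt (Real.sqrt (x - a)) := by rw [hC_def]; ring
  -- Step 3: conclusion (2), `(x − a) g → 0`
  have hii : Tendsto (fun x ↦ ((x - a : ℝ) : ℂ) * g x) (𝓝[>] a) (𝓝 0) := by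
    have hmaj : Tendsto (fun x ↦ (x - a) * A + C * (Real.sqrt (x - a) * Real.sqrt (Real.sqrt (x - a))))
        (𝓝[>] a) (𝓝 0) := by
      have hc : Continuous (fun x ↦ (x - a) * A +
          C * (Real.sqrt (x - a) * Real.sqrt (Real.sqrt (x - a)))) := by fun_prop
      have h := hc.tendsto a
      simp only [sub_self, zero_mul, Real.sqrt_zero, mul_zero, add_zero] at h
      exact h.mono_left nhdsWithin_le_nhds
    refine squeeze_zero_norm' ?_ hmaj
    filter_upwards [Ioo_mem_nhdsGT hx₀.1] with x hx
    have hxa : 0 < x - a := sub_pos.2 hx.1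
    rw [norm_mul, Complex.norm_real, Real.norm_eq_abs, abs_of_pos hxa]
    calc (x - a) * ‖g x‖ ≤ (x - a) * (A + C / Real.sqrt (Real.sqrt (x - a))) :=
          mul_le_mul_of_nonneg_left (hgrowth x ⟨hx.1, hx.2.le⟩) hxa.le
      _ = (x - a) * A + C * ((x - a) / Real.sqrt (Real.sqrt (x - a))) := by ring
      _ = (x - a) * A + C * (Real.sqrt (x - a) * Real.sqrt (Real.sqrt (x - a))) := by
          rw [div_sqrt_sqrt_eq hxa.le]
  -- Step 4: `g` is bounded on `[x₀, b)` (Grönwall for the pair `(g, P g′)`)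
  obtain ⟨M, hM⟩ : ∃ M : ℝ, ∀ x ∈ Ico x₀ b, ‖g x‖ ≤ M := by
    set K₂ : ℝ := max (1 / (m * (x₀ - a))) Q with hK₂
    have hK₂0 : 0 ≤ K₂ := hQ0.trans (le_max_right _ _)
    set f : ℝ → ℂ × ℂ := fun x ↦ (g x, w x) with hf
    set f' : ℝ → ℂ × ℂ := fun x ↦ (g' x, r x * g x) with hf'
    have hfd : ∀ x ∈ Ioo a b, HasDerivAt f (f' x) x := fun x hx ↦ (hg x hx).prodMk (hu x hx)
    refine ⟨‖f x₀‖ * Real.exp (K₂ * (b - x₀)), fun y hy ↦ ?_⟩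
    have hsub : Icc x₀ y ⊆ Ioo a b := fun t ht ↦ ⟨hx₀.1.trans_le ht.1, ht.2.trans_lt hy.2⟩
    have hpos : 0 < m * (x₀ - a) := mul_pos hm (sub_pos.2 hx₀.1)
    have hgr := norm_le_gronwallBound_of_norm_deriv_right_le (f := f) (f' := f') (δ := ‖f x₀‖)
      (K := K₂) (ε := 0) (a := x₀) (b := y)
      (fun t ht ↦ (hfd t (hsub ht)).continuousAt.continuousWithinAt)
      (fun t ht ↦ (hfd t (hsub (Ico_subset_Icc_self ht))).hasDerivWithinAt) le_rfl
      (fun t ht ↦ by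
        have htb : t ∈ Ioo a b := hsub (Ico_subset_Icc_self ht)
        rw [add_zero, hf', Prod.norm_def]
        refine max_le ?_ ?_
        · have h1 : m * (t - a) * ‖g' t‖ ≤ ‖w t‖ := by
            have := mul_le_mul_of_nonneg_right (hp t htb) (norm_nonneg (g' t))
            rw [← norm_mul] at this
            exact this
          have h2 : m * (x₀ - a) * ‖g' t‖ ≤ m * (t - a) * ‖g' t‖ := by
            have : m * (x₀ - a) ≤ m * (t - a) := by nlinarith [ht.1]
            exact mul_le_mul_of_nonneg_right this (norm_nonneg _)
          calc ‖g' t‖ ≤ ‖w t‖ / (m * (x₀ - a)) := by rw [le_div_iff₀ hpos]; linarith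
            _ = (1 / (m * (x₀ - a))) * ‖w t‖ := by ring
            _ ≤ K₂ * ‖f t‖ :=
                mul_le_mul (le_max_left _ _) (norm_snd_le (f t)) (norm_nonneg _) hK₂0
        · calc ‖r t * g t‖ ≤ Q * ‖g t‖ := by
                rw [norm_mul]; exact mul_le_mul_of_nonneg_right (hr t htb) (norm_nonneg _)
            _ ≤ K₂ * ‖f t‖ :=
                mul_le_mul (le_max_right _ _) (norm_fst_le (f t)) (norm_nonneg _) hK₂0)
      y (right_mem_Icc.2 hy.1)
    rw [gronwallBound_ε0] at hgr
    calc ‖g y‖ ≤ ‖f y‖ := norm_fst_le (f y)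
      _ ≤ ‖f x₀‖ * Real.exp (K₂ * (y - x₀)) := hgr
      _ ≤ ‖f x₀‖ * Real.exp (K₂ * (b - x₀)) := by
          gcongr
          exact hy.2.le
  -- Step 5: conclusion (3), `g ∈ L²(a,b)`
  have hI : IntervalIntegrable (fun t : ℝ ↦ (t - a) ^ (-(1 / 2 : ℝ))) volume a x₀ := by
    have h := (intervalIntegral.intervalIntegrable_rpow' (a := 0) (b := x₀ - a)
      (by norm_num : (-1 : ℝ) < -(1 / 2))).comp_sub_right a
    simpa using h
  have hrpow : ∀ t : ℝ, a < t → (Real.sqrt (t - a))⁻¹ = (t - a) ^ (-(1 / 2 : ℝ)) := by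
    intro t ht
    rw [Real.sqrt_eq_rpow, ← Real.rpow_neg (sub_pos.2 ht).le, one_div]
  have hiii : IntegrableOn (fun x ↦ ‖g x‖ ^ 2) (Ioo a b) := by
    rw [← Ioo_union_Ico_eq_Ioo hx₀.1 hx₀.2.le]
    refine IntegrableOn.union ?_ ?_
    · have hdom : IntegrableOn (fun t ↦ 2 * A ^ 2 + 2 * C ^ 2 * (t - a) ^ (-(1 / 2 : ℝ))) (Ioo a x₀) :=
        (integrableOn_const (measure_Ioo_lt_top (a := a) (b := x₀)).ne).add
          ((hI.1.mono_set Ioo_subset_Ioc_self).const_mul _)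
      refine Integrable.mono' hdom
        (((hgc.mono (Ioo_subset_Ioo_right hx₀.2.le)).norm.pow 2).aestronglyMeasurable
          measurableSet_Ioo) ?_
      rw [ae_restrict_iff' measurableSet_Ioo]
      refine ae_of_all _ fun t ht ↦ ?_
      have hta : 0 < t - a := sub_pos.2 ht.1
      rw [Real.norm_eq_abs, abs_of_nonneg (sq_nonneg _)]
      have hgt := hgrowth t ⟨ht.1, ht.2.le⟩
      set sv : ℝ := Real.sqrt (Real.sqrt (t - a)) with hsv
      have hsv0 : 0 < sv := Real.sqrt_pos.2 (Real.sqrt_pos.2 hta)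
      have e1 : (C / sv) ^ 2 = C ^ 2 * (t - a) ^ (-(1 / 2 : ℝ)) := by
        rw [div_pow, hsv, Real.sq_sqrt (Real.sqrt_nonneg _), ← hrpow t ht.1, div_eq_mul_inv]
      have h1 : ‖g t‖ ^ 2 ≤ (A + C / sv) ^ 2 := pow_le_pow_left₀ (norm_nonneg _) hgt 2
      have h2 : (A + C / sv) ^ 2 ≤ 2 * A ^ 2 + 2 * (C / sv) ^ 2 := by
        nlinarith [sq_nonneg (A - C / sv)]
      linarith [h1, h2, e1]
    · have hdom : IntegrableOn (fun _ ↦ M ^ 2) (Ico x₀ b) volume :=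
        integrableOn_const (measure_Ico_lt_top (a := x₀) (b := b)).ne
      refine Integrable.mono' hdom
        (((hgc.mono (Ico_subset_Ioo_left hx₀.1)).norm.pow 2).aestronglyMeasurable
          measurableSet_Ico) ?_
      rw [ae_restrict_iff' measurableSet_Ico]
      refine ae_of_all _ fun t ht ↦ ?_
      rw [Real.norm_eq_abs, abs_of_nonneg (sq_nonneg _)]
      exact pow_le_pow_left₀ (norm_nonneg _) (hM t ht) 2
  -- Step 6: conclusion (1), the limit of `P g′` at `a⁺`
  have hi : ∃ c : ℂ, Tendsto w (𝓝[>] a) (𝓝 c) := by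
    have hrg_int : IntegrableOn (fun t ↦ r t * g t) (Ioo a b) := by
      have hmeas : AEStronglyMeasurable (fun t ↦ r t * g t) (volume.restrict (Ioo a b)) :=
        (hrc.mul hgc).aestronglyMeasurable measurableSet_Ioo
      rw [← Ioo_union_Ico_eq_Ioo hx₀.1 hx₀.2.le]
      refine IntegrableOn.union ?_ ?_
      · have hdom : IntegrableOn
            (fun t ↦ Q * (A + C) + Q * C * (t - a) ^ (-(1 / 2 : ℝ))) (Ioo a x₀) :=
          (integrableOn_const (measure_Ioo_lt_top (a := a) (b := x₀)).ne).add
            ((hI.1.mono_set Ioo_subset_Ioc_self).const_mul _)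
        refine Integrable.mono' hdom (hmeas.mono_set (Ioo_subset_Ioo_right hx₀.2.le)) ?_
        rw [ae_restrict_iff' measurableSet_Ioo]
        refine ae_of_all _ fun t ht ↦ ?_
        have hta : 0 < t - a := sub_pos.2 ht.1
        have htb : t ∈ Ioo a b := ⟨ht.1, ht.2.trans hx₀.2⟩
        have hgt := hgrowth t ⟨ht.1, ht.2.le⟩
        have hss := inv_sqrt_sqrt_le hta
        rw [hrpow t ht.1] at hss
        have h1 : ‖r t * g t‖ ≤ Q * ‖g t‖ := by
          rw [norm_mul]; exact mul_le_mul_of_nonneg_right (hr t htb) (norm_nonneg _)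
        have h2 : C / Real.sqrt (Real.sqrt (t - a)) ≤ C * (1 + (t - a) ^ (-(1 / 2 : ℝ))) := by
          rw [div_eq_mul_inv]; exact mul_le_mul_of_nonneg_left hss hC0
        have h3 : ‖g t‖ ≤ A + C * (1 + (t - a) ^ (-(1 / 2 : ℝ))) := hgt.trans (by linarith)
        calc ‖r t * g t‖ ≤ Q * ‖g t‖ := h1
          _ ≤ Q * (A + C * (1 + (t - a) ^ (-(1 / 2 : ℝ)))) := mul_le_mul_of_nonneg_left h3 hQ0
          _ = Q * (A + C) + Q * C * (t - a) ^ (-(1 / 2 : ℝ)) := by ring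
      · have hdom : IntegrableOn (fun _ ↦ Q * M) (Ico x₀ b) volume :=
          integrableOn_const (measure_Ico_lt_top (a := x₀) (b := b)).ne
        refine Integrable.mono' hdom (hmeas.mono_set (Ico_subset_Ioo_left hx₀.1)) ?_
        rw [ae_restrict_iff' measurableSet_Ico]
        refine ae_of_all _ fun t ht ↦ ?_
        have htb : t ∈ Ioo a b := ⟨hx₀.1.trans_le ht.1, ht.2⟩
        calc ‖r t * g t‖ ≤ Q * ‖g t‖ := by
              rw [norm_mul]; exact mul_le_mul_of_nonneg_right (hr t htb) (norm_nonneg _)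
          _ ≤ Q * M := mul_le_mul_of_nonneg_left (hM t ht) hQ0
    set G : ℝ → ℂ := (Ioo a b).indicator (fun t ↦ r t * g t) with hG
    have hGint : Integrable G := (integrable_indicator_iff measurableSet_Ioo).2 hrg_int
    have hΦ : Continuous fun x ↦ ∫ t in x₀..x, G t :=
      continuous_primitive (fun _ _ ↦ hGint.intervalIntegrable) x₀
    have hrepr : ∀ x ∈ Ioo a x₀, w x = w x₀ + ∫ t in x₀..x, G t := by
      intro x hx
      have hsub : uIcc x x₀ ⊆ Ioo a b := by
        rw [uIcc_of_le hx.2.le]; exact fun t ht ↦ ⟨hx.1.trans_le ht.1, ht.2.trans_lt hx₀.2⟩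
      have hFTC : ∫ t in x..x₀, r t * g t = w x₀ - w x :=
        integral_eq_sub_of_hasDerivAt (fun t ht ↦ hu t (hsub ht))
          (((hrc.mul hgc).mono hsub).intervalIntegrable)
      have hcongr : ∫ t in x..x₀, G t = ∫ t in x..x₀, r t * g t :=
        intervalIntegral.integral_congr fun t ht ↦ by rw [hG, indicator_of_mem (hsub ht)]
      rw [intervalIntegral.integral_symm, hcongr, hFTC]
      ring
    refine ⟨w x₀ + ∫ t in x₀..a, G t, ?_⟩
    have hlim : Tendsto (fun x ↦ w x₀ + ∫ t in x₀..x, G t) (𝓝[>] a)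
        (𝓝 (w x₀ + ∫ t in x₀..a, G t)) :=
      ((continuous_const.add hΦ).tendsto a).mono_left nhdsWithin_le_nhds
    refine hlim.congr' ?_
    filter_upwards [Ioo_mem_nhdsGT hx₀.1] with x hx
    exact (hrepr x hx).symm
  exact ⟨hi, hii, hiii⟩

/-- **A-priori behaviour at a regular singular endpoint (left of `b`)**: the mirror image of
`singularEndpoint_right` under `x ↦ a + b − x` — for `(P g′)′ = r g` on `(a,b)` with `‖r‖ ≤ Q` and
`‖P(x)‖ ≥ m (b − x)`: `P g′` has a limit at `b⁻`, `(b − x) g(x) → 0` at `b⁻`, and `g ∈ L²(a,b)`.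
[cite: ConnesMoscovici2022, Lemma 1.1 (= arXiv:2112.05500 Lemma 2.1, chunk p0004:L39–L48)]
[cite: CoddingtonLevinson1955, Ch. 9 §2 and §4 (regular singular points; limit-circle case)] -/
theorem singularEndpoint_left (hab : a < b) (hm : 0 < m)
    (hg : ∀ x ∈ Ioo a b, HasDerivAt g (g' x) x)
    (hu : ∀ x ∈ Ioo a b, HasDerivAt (fun y ↦ P y * g' y) (r x * g x) x)
    (hrc : ContinuousOn r (Ioo a b)) (hr : ∀ x ∈ Ioo a b, ‖r x‖ ≤ Q)
    (hp : ∀ x ∈ Ioo a b, m * (b - x) ≤ ‖P x‖) :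
    (∃ c : ℂ, Tendsto (fun x ↦ P x * g' x) (𝓝[<] b) (𝓝 c)) ∧
      Tendsto (fun x ↦ ((b - x : ℝ) : ℂ) * g x) (𝓝[<] b) (𝓝 0) ∧
      IntegrableOn (fun x ↦ ‖g x‖ ^ 2) (Ioo a b) := by
  -- the reflection `σ x = a + b − x` of `(a,b)` onto itself
  set σ : ℝ → ℝ := fun x ↦ a + b - x with hσ
  have hσmem : ∀ x ∈ Ioo a b, σ x ∈ Ioo a b := fun x hx ↦
    ⟨by simp only [hσ]; linarith [hx.2], by simp only [hσ]; linarith [hx.1]⟩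
  have hσσ : ∀ x, σ (σ x) = x := fun x ↦ by simp only [hσ]; ring
  set gt : ℝ → ℂ := fun y ↦ g (σ y) with hgt
  set gt' : ℝ → ℂ := fun y ↦ -g' (σ y) with hgt'
  set Pt : ℝ → ℂ := fun y ↦ -P (σ y) with hPt
  set rt : ℝ → ℂ := fun y ↦ -r (σ y) with hrt
  have hgt_d : ∀ y ∈ Ioo a b, HasDerivAt gt (gt' y) y := fun y hy ↦
    HasDerivAt.comp_const_sub (a + b) y (hg (σ y) (hσmem y hy))
  have hprod : (fun y ↦ Pt y * gt' y) = fun y ↦ P (a + b - y) * g' (a + b - y) := by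
    funext y; simp only [hPt, hgt', hσ, neg_mul_neg]
  have hut : ∀ y ∈ Ioo a b, HasDerivAt (fun y ↦ Pt y * gt' y) (rt y * gt y) y := by
    intro y hy
    rw [hprod]
    have h := HasDerivAt.comp_const_sub (a + b) y (hu (σ y) (hσmem y hy))
    refine h.congr_deriv ?_
    simp only [hrt, hgt, hσ, neg_mul]
  have hσc : Continuous σ := by simp only [hσ]; fun_prop
  have hrtc : ContinuousOn rt (Ioo a b) :=
    (hrc.comp hσc.continuousOn fun y hy ↦ hσmem y hy).neg
  have hrt_le : ∀ y ∈ Ioo a b, ‖rt y‖ ≤ Q := fun y hy ↦ by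
    simp only [hrt, norm_neg]; exact hr (σ y) (hσmem y hy)
  have hpt : ∀ y ∈ Ioo a b, m * (y - a) ≤ ‖Pt y‖ := fun y hy ↦ by
    simp only [hPt, norm_neg]
    have h := hp (σ y) (hσmem y hy)
    simp only [hσ] at h
    linarith
  obtain ⟨⟨c, hc⟩, h2, h3⟩ := singularEndpoint_right hab hm hgt_d hut hrtc hrt_le hpt
  -- `σ` maps `𝓝[<] b` to `𝓝[>] a`
  have hσt : Tendsto σ (𝓝[<] b) (𝓝[>] a) := by
    have h : Tendsto σ (𝓝[Iio b] b) (𝓝[Ioi a] (σ b)) :=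
      hσc.continuousWithinAt.tendsto_nhdsWithin fun x hx ↦ by
        simp only [mem_Iio] at hx; simp only [hσ, mem_Ioi]; linarith
    have hb : σ b = a := by simp only [hσ]; ring
    rwa [hb] at h
  refine ⟨⟨c, ?_⟩, ?_, ?_⟩
  · refine (hc.comp hσt).congr fun x ↦ ?_
    simp only [Function.comp, hPt, hgt', hσσ, neg_mul_neg]
  · refine (h2.comp hσt).congr fun x ↦ ?_
    simp only [Function.comp, hgt, hσ]
    push_cast
    ring
  · -- change of variables in the `L²` statement
    have hI : IntervalIntegrable (fun y ↦ ‖gt y‖ ^ 2) volume a b :=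
      (intervalIntegrable_iff_integrableOn_Ioo_of_le hab.le).2 h3
    have hI' := hI.comp_sub_left (a + b)
    have e1 : a + b - a = b := by ring
    have e2 : a + b - b = a := by ring
    rw [e1, e2] at hI'
    have hI'' : IntervalIntegrable (fun x ↦ ‖g x‖ ^ 2) volume b a := by
      refine hI'.congr ?_
      intro x _
      simp only [hgt, hσ]
      ring_nf
    exact (intervalIntegrable_iff_integrableOn_Ioo_of_le hab.le).1 hI''.symm

end SingularEndpoint




/-! ## §3 The irregular singular point `+∞` of the prolate equation: `g, g′ = O(1/x)` -/

section AtTop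

variable {lam : ℝ}

/-- `p = λ² − x²` has derivative `−2x` (as in `UVProlateDeficiencyODE.hasDerivAt_pCoeff_def`). [cite: ConnesMoscovici2022, §1 eq. (1.1) (= arXiv (2.1), chunk p0004:L5–L9)] -/
private theorem hasDerivAt_pCoeff' (lam x : ℝ) : HasDerivAt (pCoeff lam) (((-(2 * x) : ℝ)) : ℂ) x := by
  unfold pCoeff
  have h := (((hasDerivAt_const x (lam ^ 2)).sub (hasDerivAt_pow 2 x))).ofReal_comp
  refine h.congr_deriv ?_
  push_cast; ring

/-- For `x > λ > 0`: `p(x) ≠ 0` and `‖p(x)‖ = x² − λ²`. [cite: ConnesMoscovici2022, §1 eq. (1.1) (= arXiv (2.1), chunk p0004:L5–L9)] -/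
private theorem norm_pCoeff_of_lt (hlam : 0 < lam) {x : ℝ} (hx : lam < x) :
    ‖pCoeff lam x‖ = x ^ 2 - lam ^ 2 ∧ pCoeff lam x ≠ 0 := by
  have hlt : lam ^ 2 < x ^ 2 := by nlinarith
  refine ⟨?_, ?_⟩
  · rw [pCoeff, Complex.norm_real, Real.norm_eq_abs, abs_of_nonpos (by linarith), neg_sub]
  · rw [pCoeff, Ne, Complex.ofReal_eq_zero]; exact (by linarith : lam ^ 2 - x ^ 2 ≠ 0)

/-- The second derivative of a classical solution off the singular points:
`g″ = ((q − z) g + 2x g′)/p`, from `(p g′)′ = (q − z) g` and `p′ = −2x`.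
[cite: ConnesMoscovici2022, §1 eq. (1.1) (= arXiv (2.1), chunk p0004:L5–L9)] -/
theorem prolate_hasDerivAt_deriv (hlam : 0 < lam) (z : ℂ) {g g' : ℝ → ℂ}
    (hu : ∀ x ∈ Ioi lam, HasDerivAt (fun y ↦ pCoeff lam y * g' y) ((qCoeff lam x - z) * g x) x)
    {x : ℝ} (hx : x ∈ Ioi lam) :
    HasDerivAt g' (((qCoeff lam x - z) * g x + 2 * (x : ℂ) * g' x) / pCoeff lam x) x := by
  obtain ⟨-, hpx⟩ := norm_pCoeff_of_lt hlam hx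
  have hquot := (hu x hx).div (hasDerivAt_pCoeff' lam x) hpx
  have hev : g' =ᶠ[𝓝 x] fun y ↦ pCoeff lam y * g' y / pCoeff lam y := by
    filter_upwards [Ioi_mem_nhds hx] with y hy
    rw [mul_div_cancel_left₀ _ (norm_pCoeff_of_lt hlam hy).2]
  refine (hquot.congr_of_eventuallyEq hev).congr_deriv ?_
  field_simp
  push_cast
  ring

/-- **The `v = x g` identity for complex spectral parameter** (cf. `prolate_v_identity` for real `μ`):
with `v = x g`, `v′ = g + x g′`, `v″ = 2g′ + x g″`, `ω = 2πλ`: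
`(λ² − x²)(v″ + ω² v) = 2λ² g′ + (ω²λ² − z) v`.
[cite: ConnesMoscovici2022, Cor 1.7 (ii) / Lemma 1.1 (= arXiv:2112.05500 Cor 2.7, Lemma 2.1; proof p0007:L1–L4)] -/
theorem prolate_v_identity_complex (hlam : 0 < lam) (z : ℂ) {g g' : ℝ → ℂ} {x : ℝ}
    (hx : x ∈ Ioi lam) :
    pCoeff lam x * ((2 * g' x + x * (((qCoeff lam x - z) * g x + 2 * (x : ℂ) * g' x) / pCoeff lam x))
        + ((2 * π * lam : ℝ) : ℂ) ^ 2 * (x * g x)) =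
      2 * (lam : ℂ) ^ 2 * g' x + ((((2 * π * lam) ^ 2 * lam ^ 2 : ℝ) : ℂ) - z) * (x * g x) := by
  obtain ⟨-, hpx⟩ := norm_pCoeff_of_lt hlam hx
  have e : pCoeff lam x * ((2 * g' x + x * (((qCoeff lam x - z) * g x + 2 * (x : ℂ) * g' x) / pCoeff lam x))
        + ((2 * π * lam : ℝ) : ℂ) ^ 2 * (x * g x)) =
      pCoeff lam x * (2 * g' x) + x * ((qCoeff lam x - z) * g x + 2 * (x : ℂ) * g' x)
        + pCoeff lam x * (((2 * π * lam : ℝ) : ℂ) ^ 2 * (x * g x)) := by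
    field_simp
  rw [e]
  unfold pCoeff qCoeff
  push_cast
  ring

/-- **The forcing bound at `+∞`** (complex `z`): for `x > max(2λ, 1)`,
`‖v″ + ω² v‖ ≤ (K/x²)(‖v‖ + ‖v′‖)`, `K = (4/3)(2λ² + ω²λ² + ‖z‖)`.
[cite: ConnesMoscovici2022, Cor 1.7 (ii) / Lemma 1.1 (= arXiv:2112.05500 Cor 2.7, Lemma 2.1; proof p0007:L1–L4)] -/
theorem prolate_v_forcing_bound_complex (hlam : 0 < lam) (z : ℂ) {g g' : ℝ → ℂ} {x : ℝ}
    (hx : max (2 * lam) 1 < x) :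
    ‖(2 * g' x + x * (((qCoeff lam x - z) * g x + 2 * (x : ℂ) * g' x) / pCoeff lam x))
        + ((2 * π * lam : ℝ) : ℂ) ^ 2 * (x * g x)‖ ≤
      (4 / 3 * (2 * lam ^ 2 + (2 * π * lam) ^ 2 * lam ^ 2 + ‖z‖)) / x ^ 2 *
        (‖(x : ℂ) * g x‖ + ‖g x + x * g' x‖) := by
  have h2l : 2 * lam < x := lt_of_le_of_lt (le_max_left _ _) hx
  have h1 : 1 < x := lt_of_le_of_lt (le_max_right _ _) hx
  have hx0 : 0 < x := by linarith
  have hxl : x ∈ Ioi lam := by simp only [mem_Ioi]; linarith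
  have hid := prolate_v_identity_complex hlam z (g := g) (g' := g') hxl
  obtain ⟨hp, hpx⟩ := norm_pCoeff_of_lt hlam hxl
  set V : ℂ := (x : ℂ) * g x with hV
  set V' : ℂ := g x + x * g' x with hV'
  set F : ℂ := (2 * g' x + x * (((qCoeff lam x - z) * g x + 2 * (x : ℂ) * g' x) / pCoeff lam x))
        + ((2 * π * lam : ℝ) : ℂ) ^ 2 * (x * g x) with hF
  have hp34 : 3 / 4 * x ^ 2 ≤ x ^ 2 - lam ^ 2 := by nlinarith
  have hppos : 0 < x ^ 2 - lam ^ 2 := by nlinarith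
  have hg_eq : g x = V / x := by
    rw [hV, mul_comm, mul_div_assoc, div_self (Complex.ofReal_ne_zero.2 hx0.ne'), mul_one]
  have hg'_eq : g' x = (V' - g x) / x := by
    rw [hV', eq_div_iff (Complex.ofReal_ne_zero.2 hx0.ne')]; ring
  have hng : ‖g x‖ ≤ ‖V‖ := by
    rw [hg_eq, norm_div, Complex.norm_real, Real.norm_eq_abs, abs_of_pos hx0]
    exact div_le_self (norm_nonneg _) h1.le
  have hng' : ‖g' x‖ ≤ ‖V‖ + ‖V'‖ := by
    rw [hg'_eq, norm_div, Complex.norm_real, Real.norm_eq_abs, abs_of_pos hx0]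
    calc ‖V' - g x‖ / x ≤ ‖V' - g x‖ := div_le_self (norm_nonneg _) h1.le
      _ ≤ ‖V'‖ + ‖g x‖ := norm_sub_le _ _
      _ ≤ ‖V‖ + ‖V'‖ := by linarith
  set K₀ : ℝ := 2 * lam ^ 2 + (2 * π * lam) ^ 2 * lam ^ 2 + ‖z‖ with hK₀
  have hnum : ‖pCoeff lam x * F‖ ≤ K₀ * (‖V‖ + ‖V'‖) := by
    rw [hF, hid]
    calc ‖2 * (lam : ℂ) ^ 2 * g' x + ((((2 * π * lam) ^ 2 * lam ^ 2 : ℝ) : ℂ) - z) * (x * g x)‖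
        ≤ ‖2 * (lam : ℂ) ^ 2 * g' x‖ + ‖((((2 * π * lam) ^ 2 * lam ^ 2 : ℝ) : ℂ) - z) * (x * g x)‖ :=
          norm_add_le _ _
      _ = 2 * lam ^ 2 * ‖g' x‖ + ‖(((2 * π * lam) ^ 2 * lam ^ 2 : ℝ) : ℂ) - z‖ * ‖V‖ := by
          have ha : ‖2 * (lam : ℂ) ^ 2 * g' x‖ = 2 * lam ^ 2 * ‖g' x‖ := by
            rw [norm_mul, norm_mul, norm_pow, Complex.norm_real, Real.norm_eq_abs, abs_of_pos hlam,
              Complex.norm_two]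
          rw [ha, norm_mul]
      _ ≤ 2 * lam ^ 2 * (‖V‖ + ‖V'‖) + ((2 * π * lam) ^ 2 * lam ^ 2 + ‖z‖) * ‖V‖ := by
          gcongr
          calc ‖(((2 * π * lam) ^ 2 * lam ^ 2 : ℝ) : ℂ) - z‖
              ≤ ‖(((2 * π * lam) ^ 2 * lam ^ 2 : ℝ) : ℂ)‖ + ‖z‖ := norm_sub_le _ _
            _ = (2 * π * lam) ^ 2 * lam ^ 2 + ‖z‖ := by
                rw [Complex.norm_real, Real.norm_eq_abs, abs_of_nonneg (by positivity)]
      _ ≤ K₀ * (‖V‖ + ‖V'‖) := by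
          rw [hK₀]
          nlinarith [mul_nonneg (by positivity : (0:ℝ) ≤ (2 * π * lam) ^ 2 * lam ^ 2 + ‖z‖)
            (norm_nonneg V')]
  have hFle : ‖F‖ ≤ K₀ * (‖V‖ + ‖V'‖) / (x ^ 2 - lam ^ 2) := by
    rw [le_div_iff₀ hppos, ← hp, mul_comm, ← norm_mul]
    exact hnum
  calc ‖F‖ ≤ K₀ * (‖V‖ + ‖V'‖) / (x ^ 2 - lam ^ 2) := hFle
    _ ≤ K₀ * (‖V‖ + ‖V'‖) / (3 / 4 * x ^ 2) :=
        div_le_div_of_nonneg_left (by positivity) (by positivity) hp34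
    _ = (4 / 3 * K₀) / x ^ 2 * (‖V‖ + ‖V'‖) := by
        field_simp

/-- **A-priori decay at the irregular singular point `+∞`** of the prolate equation
`((λ² − x²) g′)′ = ((2πλx)² − z) g` (`λ > 0`, `z ∈ ℂ` arbitrary, pointwise `HasDerivAt` hypotheses
on `(λ, ∞)`): `‖g(x)‖, ‖g′(x)‖ ≤ C/x` for `x > max(2λ, 1)`.  With `v = x g` the energy
`Φ = ω²‖v‖² + ‖v′‖²` has `Φ′ = 2⟨v′, v″ + ω²v⟩ ≤ (K′/x²)Φ` (`prolate_v_forcing_bound_complex`), so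
`Φ e^{K′/x}` is antitone and `v, v′` are bounded — NO boundary condition at `∞` is assumed.
[cite: ConnesMoscovici2022, Lemma 1.1 and Cor 1.7 (ii) (= arXiv:2112.05500 Lemma 2.1, Cor 2.7; chunk p0004:L39–L48, proof p0007:L1–L4)] -/
theorem prolate_decay_atTop (hlam : 0 < lam) (z : ℂ) {g g' : ℝ → ℂ}
    (hg : ∀ x ∈ Ioi lam, HasDerivAt g (g' x) x)
    (hu : ∀ x ∈ Ioi lam, HasDerivAt (fun y ↦ pCoeff lam y * g' y) ((qCoeff lam x - z) * g x) x) :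
    ∃ C : ℝ, ∀ x : ℝ, max (2 * lam) 1 < x → ‖g x‖ ≤ C / x ∧ ‖g' x‖ ≤ C / x := by
  set w : ℝ := 2 * π * lam with hw_def
  have hw : 0 < w := by positivity
  set x₀ : ℝ := max (2 * lam) 1 with hx₀
  have hx₀1 : 1 ≤ x₀ := le_max_right _ _
  have hx₀pos : 0 < x₀ := lt_of_lt_of_le one_pos hx₀1
  have hsub : Ici x₀ ⊆ Ioi lam := fun x hx ↦ by
    have h2l : 2 * lam ≤ x := (le_max_left _ _).trans hx
    simp only [mem_Ioi]; linarith
  -- `v, v′, v″` and the second derivative of `g`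
  set g'' : ℝ → ℂ := fun x ↦ ((qCoeff lam x - z) * g x + 2 * (x : ℂ) * g' x) / pCoeff lam x with hg''
  set v : ℝ → ℂ := fun x ↦ (x : ℂ) * g x with hv_def
  set v' : ℝ → ℂ := fun x ↦ g x + x * g' x with hv'_def
  set v'' : ℝ → ℂ := fun x ↦ 2 * g' x + x * g'' x with hv''_def
  have hid : ∀ x : ℝ, HasDerivAt (fun y : ℝ ↦ (y : ℂ)) 1 x := fun x ↦ by
    simpa using (hasDerivAt_id x).ofReal_comp
  have hv : ∀ x ∈ Ioi lam, HasDerivAt v (v' x) x := by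
    intro x hx
    refine ((hid x).mul (hg x hx)).congr_deriv ?_
    simp only [hv'_def]; ring
  have hv' : ∀ x ∈ Ioi lam, HasDerivAt v' (v'' x) x := by
    intro x hx
    have h2 : HasDerivAt g' (g'' x) x := prolate_hasDerivAt_deriv hlam z hu hx
    refine ((hg x hx).add ((hid x).mul h2)).congr_deriv ?_
    simp only [hv''_def]; ring
  -- the forcing bound
  set K : ℝ := 4 / 3 * (2 * lam ^ 2 + (2 * π * lam) ^ 2 * lam ^ 2 + ‖z‖) with hK
  have hK0 : 0 ≤ K := by positivity
  have hF : ∀ x, x₀ < x → ‖v'' x + (w : ℂ) ^ 2 * v x‖ ≤ K / x ^ 2 * (‖v x‖ + ‖v' x‖) := by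
    intro x hx
    have h := prolate_v_forcing_bound_complex hlam z (g := g) (g' := g') hx
    simp only [hv''_def, hv_def, hv'_def, hg'', hw_def]
    push_cast at h ⊢
    exact h
  -- the energy `Φ = ω²‖v‖² + ‖v′‖²` and its derivative
  set Φ : ℝ → ℝ := fun x ↦ w ^ 2 * ‖v x‖ ^ 2 + ‖v' x‖ ^ 2 with hΦ
  set Φ' : ℝ → ℝ := fun x ↦ w ^ 2 * (2 * ⟪v x, v' x⟫_ℝ) + 2 * ⟪v' x, v'' x⟫_ℝ with hΦ'
  have hΦd : ∀ x ∈ Ioi lam, HasDerivAt Φ (Φ' x) x := fun x hx ↦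
    ((hv x hx).norm_sq.const_mul (w ^ 2)).add (hv' x hx).norm_sq
  set K' : ℝ := K * (2 + 1 / w) with hK'
  have hK'0 : 0 ≤ K' := by positivity
  have hΦ0 : ∀ x, 0 ≤ Φ x := fun x ↦ by simp only [hΦ]; positivity
  -- `Φ′ ≤ (K′/x²) Φ` for `x > x₀`
  have hΦineq : ∀ x, x₀ < x → Φ' x ≤ K' * (x ^ 2)⁻¹ * Φ x := by
    intro x hx
    have hx0 : 0 < x := hx₀pos.trans hx
    -- `Φ′ = 2⟨v′, v″ + ω²v⟩`
    have key : ∀ a b c : ℂ, ⟪b, c + (w : ℂ) ^ 2 * a⟫_ℝ = ⟪b, c⟫_ℝ + w ^ 2 * ⟪a, b⟫_ℝ := by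
      intro a b c
      have hsm : (w : ℂ) ^ 2 * a = (w ^ 2 : ℝ) • a := by
        rw [Complex.real_smul]; push_cast; ring
      rw [inner_add_right, hsm, real_inner_smul_right, real_inner_comm a b]
    have e1 : Φ' x = 2 * ⟪v' x, v'' x + (w : ℂ) ^ 2 * v x⟫_ℝ := by
      rw [key]; simp only [hΦ']; ring
    have hi : |⟪v' x, v'' x + (w : ℂ) ^ 2 * v x⟫_ℝ| ≤ ‖v' x‖ * ‖v'' x + (w : ℂ) ^ 2 * v x‖ :=
      abs_real_inner_le_norm _ _
    have hFx := hF x hx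
    have hc0 : 0 ≤ K / x ^ 2 := by positivity
    have h1 : Φ' x ≤ 2 * (‖v' x‖ * (K / x ^ 2 * (‖v x‖ + ‖v' x‖))) := by
      rw [e1]
      have := (abs_le.1 hi).2
      nlinarith [norm_nonneg (v' x), mul_le_mul_of_nonneg_left hFx (norm_nonneg (v' x))]
    -- AM–GM: `2‖v′‖‖v‖ ≤ Φ/ω`, `2‖v′‖² ≤ 2Φ`
    have h2 : 2 * (‖v' x‖ * ‖v x‖) ≤ Φ x / w := by
      rw [le_div_iff₀ hw]
      simp only [hΦ]
      nlinarith [sq_nonneg (w * ‖v x‖ - ‖v' x‖)]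
    have h3 : 2 * (‖v' x‖ * (K / x ^ 2 * (‖v x‖ + ‖v' x‖)))
        = K / x ^ 2 * (2 * (‖v' x‖ * ‖v x‖) + 2 * ‖v' x‖ ^ 2) := by ring
    have h4 : 2 * ‖v' x‖ ^ 2 ≤ 2 * Φ x := by
      simp only [hΦ]; nlinarith [sq_nonneg (w * ‖v x‖)]
    have h5 : K / x ^ 2 * (2 * (‖v' x‖ * ‖v x‖) + 2 * ‖v' x‖ ^ 2) ≤ K / x ^ 2 * (Φ x / w + 2 * Φ x) :=
      mul_le_mul_of_nonneg_left (by linarith) hc0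
    have h6 : K / x ^ 2 * (Φ x / w + 2 * Φ x) = K' * (x ^ 2)⁻¹ * Φ x := by
      rw [hK']; field_simp; ring
    linarith [h1, h3, h5, h6]
  -- `Ψ = Φ e^{K′/x}` is antitone on `[x₀, ∞)`
  set Ψ : ℝ → ℝ := fun x ↦ Φ x * Real.exp (K' * x⁻¹) with hΨ
  have hΨd : ∀ x ∈ Ioi lam, x ≠ 0 → HasDerivAt Ψ
      (Φ' x * Real.exp (K' * x⁻¹) + Φ x * (Real.exp (K' * x⁻¹) * (K' * -(x ^ 2)⁻¹))) x := by
    intro x hx hx0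
    have he : HasDerivAt (fun y ↦ Real.exp (K' * y⁻¹)) (Real.exp (K' * x⁻¹) * (K' * -(x ^ 2)⁻¹)) x :=
      ((hasDerivAt_inv hx0).const_mul K').exp
    exact (hΦd x hx).mul he
  have hΨanti : AntitoneOn Ψ (Ici x₀) := by
    refine antitoneOn_of_hasDerivWithinAt_nonpos (convex_Ici x₀)
      (f' := fun x ↦ Φ' x * Real.exp (K' * x⁻¹) + Φ x * (Real.exp (K' * x⁻¹) * (K' * -(x ^ 2)⁻¹)))
      (fun x hx ↦ (hΨd x (hsub hx) (hx₀pos.trans_le hx).ne').continuousAt.continuousWithinAt)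
      (fun x hx ↦ ?_) (fun x hx ↦ ?_)
    · rw [interior_Ici] at hx ⊢
      exact (hΨd x (hsub (mem_Ici.2 (le_of_lt hx))) (hx₀pos.trans hx).ne').hasDerivWithinAt
    · rw [interior_Ici] at hx
      have hx' : x₀ < x := hx
      have hex : 0 < Real.exp (K' * x⁻¹) := Real.exp_pos _
      have hin := hΦineq x hx'
      have e : Φ' x * Real.exp (K' * x⁻¹) + Φ x * (Real.exp (K' * x⁻¹) * (K' * -(x ^ 2)⁻¹))
          = Real.exp (K' * x⁻¹) * (Φ' x - K' * (x ^ 2)⁻¹ * Φ x) := by ring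
      rw [e]
      exact mul_nonpos_of_nonneg_of_nonpos hex.le (by linarith)
  -- bounds for `v`, `v′` on `[x₀, ∞)`
  set R : ℝ := Real.sqrt (Ψ x₀) with hR
  have hR0 : 0 ≤ R := Real.sqrt_nonneg _
  have hΦle : ∀ x, x₀ ≤ x → Φ x ≤ Ψ x₀ := by
    intro x hx
    have hx0 : 0 < x := hx₀pos.trans_le hx
    have h1 : Ψ x ≤ Ψ x₀ := hΨanti self_mem_Ici hx hx
    have h2 : Φ x ≤ Ψ x := by
      simp only [hΨ]
      have : 1 ≤ Real.exp (K' * x⁻¹) := Real.one_le_exp (by positivity)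
      nlinarith [hΦ0 x]
    exact h2.trans h1
  have hvb : ∀ x, x₀ ≤ x → ‖v x‖ ≤ R / w ∧ ‖v' x‖ ≤ R := by
    intro x hx
    have h := hΦle x hx
    have hΦx : Φ x = w ^ 2 * ‖v x‖ ^ 2 + ‖v' x‖ ^ 2 := rfl
    refine ⟨?_, ?_⟩
    · rw [le_div_iff₀ hw]
      calc ‖v x‖ * w = Real.sqrt ((w * ‖v x‖) ^ 2) := by
            rw [Real.sqrt_sq (by positivity)]; ring
        _ ≤ R := Real.sqrt_le_sqrt (by nlinarith [sq_nonneg ‖v' x‖])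
    · calc ‖v' x‖ = Real.sqrt (‖v' x‖ ^ 2) := (Real.sqrt_sq (norm_nonneg _)).symm
        _ ≤ R := Real.sqrt_le_sqrt (by nlinarith [sq_nonneg (w * ‖v x‖)])
  -- conclusion
  refine ⟨R + R / w, fun x hx ↦ ?_⟩
  have hx' : x₀ < x := hx
  have hx0 : 0 < x := hx₀pos.trans hx'
  have h1 : 1 < x := lt_of_le_of_lt hx₀1 hx'
  obtain ⟨hvx, hv'x⟩ := hvb x hx'.le
  have hxC : (x : ℂ) ≠ 0 := Complex.ofReal_ne_zero.2 hx0.ne'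
  have hg_eq : g x = v x / x := by
    simp only [hv_def]; rw [mul_div_cancel_left₀ _ hxC]
  have hg'_eq : g' x = (v' x - g x) / x := by
    simp only [hv'_def]; rw [eq_div_iff hxC]; ring
  have hng : ‖g x‖ = ‖v x‖ / x := by
    rw [hg_eq, norm_div, Complex.norm_real, Real.norm_eq_abs, abs_of_pos hx0]
  have hng_le : ‖g x‖ ≤ R / w := by
    rw [hng]; exact (div_le_self (norm_nonneg _) h1.le).trans hvx
  have hRw : 0 ≤ R / w := by positivity
  refine ⟨?_, ?_⟩
  · rw [hng]
    exact div_le_div_of_nonneg_right (hvx.trans (by linarith)) hx0.le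
  · rw [hg'_eq, norm_div, Complex.norm_real, Real.norm_eq_abs, abs_of_pos hx0]
    refine div_le_div_of_nonneg_right ?_ hx0.le
    calc ‖v' x - g x‖ ≤ ‖v' x‖ + ‖g x‖ := norm_sub_le _ _
      _ ≤ R + R / w := add_le_add hv'x hng_le

/-- **Square integrability at `+∞`**: under the hypotheses of `prolate_decay_atTop`, `g ∈ L²(x₁, ∞)` for
every `x₁ > λ` ("any solution of `Wξ = ±iξ` belongs to `Dom(W_max)`", the `+∞` half).
[cite: ConnesMoscovici2022, Lemma 1.1 (= arXiv:2112.05500 Lemma 2.1, chunk p0004:L39–L48)] -/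
theorem prolate_sq_integrableOn_Ioi (hlam : 0 < lam) (z : ℂ) {g g' : ℝ → ℂ}
    (hg : ∀ x ∈ Ioi lam, HasDerivAt g (g' x) x)
    (hu : ∀ x ∈ Ioi lam, HasDerivAt (fun y ↦ pCoeff lam y * g' y) ((qCoeff lam x - z) * g x) x)
    {x₁ : ℝ} (hx₁ : lam < x₁) : IntegrableOn (fun x ↦ ‖g x‖ ^ 2) (Ioi x₁) := by
  obtain ⟨C, hC⟩ := prolate_decay_atTop hlam z hg hu
  have hgc : ContinuousOn g (Ioi lam) := fun x hx ↦ (hg x hx).continuousAt.continuousWithinAt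
  set T : ℝ := max x₁ (max (2 * lam) 1 + 1) with hT
  have hT₁ : x₁ ≤ T := le_max_left _ _
  have hT₀ : max (2 * lam) 1 < T := by
    have : max (2 * lam) 1 + 1 ≤ T := le_max_right _ _
    linarith
  have hTpos : 0 < T := lt_of_le_of_lt (le_max_right _ _) hT₀ |> lt_trans one_pos
  rw [← Ioc_union_Ioi_eq_Ioi hT₁]
  refine IntegrableOn.union ?_ ?_
  · -- compact part
    have hsub : Icc x₁ T ⊆ Ioi lam := fun x hx ↦ lt_of_lt_of_le hx₁ hx.1
    exact (((hgc.mono hsub).norm.pow 2).integrableOn_Icc).mono_set Ioc_subset_Icc_self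
  · -- tail: `‖g‖² ≤ C² x⁻²`
    have hsub : Ioi T ⊆ Ioi lam := fun x hx ↦ by
      simp only [mem_Ioi] at hx ⊢; nlinarith [le_max_left (2 * lam) 1, hT₀]
    have hdom : IntegrableOn (fun x : ℝ ↦ C ^ 2 * x ^ (-2 : ℝ)) (Ioi T) :=
      (integrableOn_Ioi_rpow_of_lt (by norm_num : (-2 : ℝ) < -1) hTpos).const_mul (C ^ 2)
    refine Integrable.mono' hdom (((hgc.mono hsub).norm.pow 2).aestronglyMeasurable measurableSet_Ioi) ?_
    rw [ae_restrict_iff' measurableSet_Ioi]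
    refine ae_of_all _ fun x hx ↦ ?_
    have hx' : max (2 * lam) 1 < x := hT₀.trans hx
    have hx0 : 0 < x := hTpos.trans hx
    obtain ⟨h1, -⟩ := hC x hx'
    rw [Real.norm_eq_abs, abs_of_nonneg (sq_nonneg _)]
    have e : C ^ 2 * x ^ (-2 : ℝ) = (C / x) ^ 2 := by
      rw [Real.rpow_neg hx0.le, show (2 : ℝ) = (2 : ℕ) by norm_num, Real.rpow_natCast, div_pow,
        div_eq_mul_inv]
    rw [e]
    exact pow_le_pow_left₀ (norm_nonneg _) h1 2

end AtTop


/-! ## §4 When the logarithmic coefficient vanishes: finite limits and vanishing Wronskians -/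

section LogCoefficient

variable {a b m Q : ℝ} {g g' h h' P r : ℝ → ℂ}

/-- A solution pair `(g, g′)` with `g′ = (P g′)/P`, `P` continuous and non-vanishing, is `C¹`. [folklore] -/
private theorem contDiffOn_one_of_pair (hg : ∀ x ∈ Ioo a b, HasDerivAt g (g' x) x)
    (hu : ∀ x ∈ Ioo a b, HasDerivAt (fun y ↦ P y * g' y) (r x * g x) x)
    (hPc : ContinuousOn P (Ioo a b)) (hP0 : ∀ x ∈ Ioo a b, P x ≠ 0) :
    ContDiffOn ℝ 1 g (Ioo a b) ∧ ∀ x ∈ Ioo a b, deriv g x = g' x := by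
  have hderiv : ∀ x ∈ Ioo a b, deriv g x = g' x := fun x hx ↦ (hg x hx).deriv
  refine ⟨?_, hderiv⟩
  rw [contDiffOn_one_iff_derivWithin (uniqueDiffOn_Ioo a b)]
  refine ⟨fun x hx ↦ (hg x hx).differentiableAt.differentiableWithinAt, ?_⟩
  have hwc : ContinuousOn (fun y ↦ P y * g' y) (Ioo a b) :=
    fun x hx ↦ (hu x hx).continuousAt.continuousWithinAt
  have hq : ContinuousOn (fun y ↦ P y * g' y / P y) (Ioo a b) := hwc.div hPc hP0
  refine hq.congr fun x hx ↦ ?_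
  simp only [derivWithin_of_isOpen isOpen_Ioo hx, hderiv x hx]
  rw [mul_div_cancel_left₀ _ (hP0 x hx)]

/-- **Finite limit when the logarithmic coefficient vanishes (right of `a`)**: under the hypotheses of
`singularEndpoint_right` plus continuity of `P`, if `P g′ → 0` at `a⁺` then `g` has a finite limit at
`a⁺` (the a-priori `L²` bound of `singularEndpoint_right` feeds
`exists_tendsto_nhdsGT_of_singular_endpoint`).
[cite: ConnesMoscovici2022, Lemma 1.1 (= arXiv:2112.05500 Lemma 2.1, chunk p0004:L39–L48); Cor 1.7 (i)] -/
theorem exists_tendsto_of_singularEndpoint_right (hab : a < b) (hm : 0 < m)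
    (hg : ∀ x ∈ Ioo a b, HasDerivAt g (g' x) x)
    (hu : ∀ x ∈ Ioo a b, HasDerivAt (fun y ↦ P y * g' y) (r x * g x) x)
    (hrc : ContinuousOn r (Ioo a b)) (hr : ∀ x ∈ Ioo a b, ‖r x‖ ≤ Q)
    (hPc : ContinuousOn P (Ioo a b)) (hp : ∀ x ∈ Ioo a b, m * (x - a) ≤ ‖P x‖)
    (hbc : Tendsto (fun x ↦ P x * g' x) (𝓝[>] a) (𝓝 0)) :
    ∃ ℓ : ℂ, Tendsto g (𝓝[>] a) (𝓝 ℓ) := by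
  have hP0 : ∀ x ∈ Ioo a b, P x ≠ 0 := fun x hx h ↦ by
    have := hp x hx; rw [h, norm_zero] at this; nlinarith [sub_pos.2 hx.1]
  obtain ⟨hC1, hderiv⟩ := contDiffOn_one_of_pair hg hu hPc hP0
  obtain ⟨-, -, hL2⟩ := singularEndpoint_right hab hm hg hu hrc hr hp
  have hev : ∀ x ∈ Ioo a b, P x * deriv g x = P x * g' x := fun x hx ↦ by rw [hderiv x hx]
  have hu' : ∀ x ∈ Ioo a b, HasDerivAt (fun y ↦ P y * deriv g y) (r x * g x) x := by
    intro x hx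
    refine (hu x hx).congr_of_eventuallyEq ?_
    filter_upwards [Ioo_mem_nhds hx.1 hx.2] with y hy using hev y hy
  have hbc' : Tendsto (fun x ↦ P x * deriv g x) (𝓝[>] a) (𝓝 0) :=
    hbc.congr' (by filter_upwards [Ioo_mem_nhdsGT hab] with y hy using (hev y hy).symm)
  exact exists_tendsto_nhdsGT_of_singular_endpoint hab hm hC1 hu' hrc hr hp hbc' hL2

/-- **Finite limit when the logarithmic coefficient vanishes (left of `b`)**: mirror of
`exists_tendsto_of_singularEndpoint_right`.
[cite: ConnesMoscovici2022, Lemma 1.1 (= arXiv:2112.05500 Lemma 2.1, chunk p0004:L39–L48); Cor 1.7 (i)] -/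
theorem exists_tendsto_of_singularEndpoint_left (hab : a < b) (hm : 0 < m)
    (hg : ∀ x ∈ Ioo a b, HasDerivAt g (g' x) x)
    (hu : ∀ x ∈ Ioo a b, HasDerivAt (fun y ↦ P y * g' y) (r x * g x) x)
    (hrc : ContinuousOn r (Ioo a b)) (hr : ∀ x ∈ Ioo a b, ‖r x‖ ≤ Q)
    (hPc : ContinuousOn P (Ioo a b)) (hp : ∀ x ∈ Ioo a b, m * (b - x) ≤ ‖P x‖)
    (hbc : Tendsto (fun x ↦ P x * g' x) (𝓝[<] b) (𝓝 0)) :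
    ∃ ℓ : ℂ, Tendsto g (𝓝[<] b) (𝓝 ℓ) := by
  have hP0 : ∀ x ∈ Ioo a b, P x ≠ 0 := fun x hx h ↦ by
    have := hp x hx; rw [h, norm_zero] at this; nlinarith [sub_pos.2 hx.2]
  obtain ⟨hC1, hderiv⟩ := contDiffOn_one_of_pair hg hu hPc hP0
  obtain ⟨-, -, hL2⟩ := singularEndpoint_left hab hm hg hu hrc hr hp
  have hev : ∀ x ∈ Ioo a b, P x * deriv g x = P x * g' x := fun x hx ↦ by rw [hderiv x hx]
  have hu' : ∀ x ∈ Ioo a b, HasDerivAt (fun y ↦ P y * deriv g y) (r x * g x) x := by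
    intro x hx
    refine (hu x hx).congr_of_eventuallyEq ?_
    filter_upwards [Ioo_mem_nhds hx.1 hx.2] with y hy using hev y hy
  have hbc' : Tendsto (fun x ↦ P x * deriv g x) (𝓝[<] b) (𝓝 0) :=
    hbc.congr' (by filter_upwards [Ioo_mem_nhdsLT hab] with y hy using (hev y hy).symm)
  exact exists_tendsto_nhdsLT_of_singular_endpoint hab hm hC1 hu' hrc hr hp hbc' hL2

/-- **Two solutions with vanishing logarithmic coefficients have Wronskian `→ 0` (right of `a`)**:
for two solution pairs of the SAME equation `(P g′)′ = r g` on `(a,b)` with `P g′ → 0` and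
`P h′ → 0` at `a⁺`, the Wronskian `g·(P h′) − h·(P g′)` tends to `0` at `a⁺` (both `g`, `h` have
finite limits there).  With Abel's identity (`UVProlateDeficiencyODE.wronskian_sol_eq`: the Wronskian
is constant) it vanishes identically, so the limit functional `g ↦ lim_{a⁺} P g′` is non-zero on any
two-dimensional solution space — the non-degeneracy behind the count `6 − 2 = 4`.
[cite: ConnesMoscovici2022, Lemma 1.1 (= arXiv:2112.05500 Lemma 2.1, chunk p0004:L39–L48); §1 eqs. (1.5)–(1.6)] -/
theorem wronskian_tendsto_zero_of_tendsto_zero (hab : a < b) (hm : 0 < m)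
    (hg : ∀ x ∈ Ioo a b, HasDerivAt g (g' x) x)
    (hgu : ∀ x ∈ Ioo a b, HasDerivAt (fun y ↦ P y * g' y) (r x * g x) x)
    (hh : ∀ x ∈ Ioo a b, HasDerivAt h (h' x) x)
    (hhu : ∀ x ∈ Ioo a b, HasDerivAt (fun y ↦ P y * h' y) (r x * h x) x)
    (hrc : ContinuousOn r (Ioo a b)) (hr : ∀ x ∈ Ioo a b, ‖r x‖ ≤ Q)
    (hPc : ContinuousOn P (Ioo a b)) (hp : ∀ x ∈ Ioo a b, m * (x - a) ≤ ‖P x‖)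
    (hgbc : Tendsto (fun x ↦ P x * g' x) (𝓝[>] a) (𝓝 0))
    (hhbc : Tendsto (fun x ↦ P x * h' x) (𝓝[>] a) (𝓝 0)) :
    Tendsto (fun x ↦ g x * (P x * h' x) - h x * (P x * g' x)) (𝓝[>] a) (𝓝 0) := by
  obtain ⟨ℓg, hℓg⟩ := exists_tendsto_of_singularEndpoint_right hab hm hg hgu hrc hr hPc hp hgbc
  obtain ⟨ℓh, hℓh⟩ := exists_tendsto_of_singularEndpoint_right hab hm hh hhu hrc hr hPc hp hhbc
  have h := (hℓg.mul hhbc).sub (hℓh.mul hgbc)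
  simpa using h

/-- Mirror of `wronskian_tendsto_zero_of_tendsto_zero` at `b⁻`.
[cite: ConnesMoscovici2022, Lemma 1.1 (= arXiv:2112.05500 Lemma 2.1, chunk p0004:L39–L48); §1 eqs. (1.5)–(1.6)] -/
theorem wronskian_tendsto_zero_of_tendsto_zero_left (hab : a < b) (hm : 0 < m)
    (hg : ∀ x ∈ Ioo a b, HasDerivAt g (g' x) x)
    (hgu : ∀ x ∈ Ioo a b, HasDerivAt (fun y ↦ P y * g' y) (r x * g x) x)
    (hh : ∀ x ∈ Ioo a b, HasDerivAt h (h' x) x)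
    (hhu : ∀ x ∈ Ioo a b, HasDerivAt (fun y ↦ P y * h' y) (r x * h x) x)
    (hrc : ContinuousOn r (Ioo a b)) (hr : ∀ x ∈ Ioo a b, ‖r x‖ ≤ Q)
    (hPc : ContinuousOn P (Ioo a b)) (hp : ∀ x ∈ Ioo a b, m * (b - x) ≤ ‖P x‖)
    (hgbc : Tendsto (fun x ↦ P x * g' x) (𝓝[<] b) (𝓝 0))
    (hhbc : Tendsto (fun x ↦ P x * h' x) (𝓝[<] b) (𝓝 0)) :
    Tendsto (fun x ↦ g x * (P x * h' x) - h x * (P x * g' x)) (𝓝[<] b) (𝓝 0) := by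
  obtain ⟨ℓg, hℓg⟩ := exists_tendsto_of_singularEndpoint_left hab hm hg hgu hrc hr hPc hp hgbc
  obtain ⟨ℓh, hℓh⟩ := exists_tendsto_of_singularEndpoint_left hab hm hh hhu hrc hr hPc hp hhbc
  have h := (hℓg.mul hhbc).sub (hℓh.mul hgbc)
  simpa using h

end LogCoefficient

/-! ## §5 The mirror `x ↦ −x`: decay and square integrability at `−∞` -/

section AtBot

variable {lam : ℝ}

/-- The reflected pair `(g(−·), −g′(−·))` of a solution pair on `(−∞, −λ)` is a solution pair on
`(λ, ∞)` (the equation is even: `p(−x) = p(x)`, `q(−x) = q(x)`). [cite: ConnesMoscovici2022, §1 eq. (1.1) (= arXiv (2.1), chunk p0004:L5–L9)] -/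
private theorem reflect_sol (lam : ℝ) (z : ℂ) {g g' : ℝ → ℂ}
    (hg : ∀ x ∈ Iio (-lam), HasDerivAt g (g' x) x)
    (hu : ∀ x ∈ Iio (-lam), HasDerivAt (fun y ↦ pCoeff lam y * g' y) ((qCoeff lam x - z) * g x) x) :
    (∀ y ∈ Ioi lam, HasDerivAt (fun y ↦ g (-y)) (-g' (-y)) y) ∧
      ∀ y ∈ Ioi lam, HasDerivAt (fun y ↦ pCoeff lam y * -g' (-y)) ((qCoeff lam y - z) * g (-y)) y := by
  have hmem : ∀ y ∈ Ioi lam, -y ∈ Iio (-lam) := fun y hy ↦ by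
    simp only [mem_Ioi, mem_Iio] at hy ⊢; linarith
  have hpe : ∀ y : ℝ, pCoeff lam (-y) = pCoeff lam y := fun y ↦ by simp [pCoeff]
  have hqe : ∀ y : ℝ, qCoeff lam (-y) = qCoeff lam y := fun y ↦ by simp [qCoeff]
  refine ⟨fun y hy ↦ ?_, fun y hy ↦ ?_⟩
  · have h := (hg (-y) (hmem y hy)).scomp y (hasDerivAt_neg y)
    exact h.congr_deriv (by rw [neg_one_smul])
  · have hprod : (fun y ↦ pCoeff lam y * -g' (-y)) = fun y ↦ -(pCoeff lam (-y) * g' (-y)) := by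
      funext y; rw [hpe, mul_neg]
    rw [hprod]
    have h := ((hu (-y) (hmem y hy)).scomp y (hasDerivAt_neg y)).neg
    exact h.congr_deriv (by rw [neg_one_smul, neg_neg, hqe])

/-- **A-priori decay at `−∞`**: the `x ↦ −x` mirror of `prolate_decay_atTop` (the equation is even:
`p(−x) = p(x)`, `q(−x) = q(x)`): for a solution pair on `(−∞, −λ)`, `‖g(x)‖, ‖g′(x)‖ ≤ C/|x|` for
`x < −max(2λ, 1)`.
[cite: ConnesMoscovici2022, Lemma 1.1 and Cor 1.7 (ii) (= arXiv:2112.05500 Lemma 2.1, Cor 2.7; chunk p0004:L39–L48, proof p0007:L1–L4)] -/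
theorem prolate_decay_atBot (hlam : 0 < lam) (z : ℂ) {g g' : ℝ → ℂ}
    (hg : ∀ x ∈ Iio (-lam), HasDerivAt g (g' x) x)
    (hu : ∀ x ∈ Iio (-lam), HasDerivAt (fun y ↦ pCoeff lam y * g' y) ((qCoeff lam x - z) * g x) x) :
    ∃ C : ℝ, ∀ x : ℝ, x < -max (2 * lam) 1 → ‖g x‖ ≤ C / (-x) ∧ ‖g' x‖ ≤ C / (-x) := by
  obtain ⟨hgt_d, hut⟩ := reflect_sol lam z hg hu
  obtain ⟨C, hC⟩ := prolate_decay_atTop hlam z hgt_d hut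
  refine ⟨C, fun x hx ↦ ?_⟩
  have hx' : max (2 * lam) 1 < -x := by linarith
  obtain ⟨h1, h2⟩ := hC (-x) hx'
  simp only [neg_neg, norm_neg] at h1 h2
  exact ⟨h1, h2⟩

/-- **Square integrability at `−∞`**: for a solution pair on `(−∞, −λ)`, `g ∈ L²(−∞, x₁)` for every
`x₁ < −λ`. [cite: ConnesMoscovici2022, Lemma 1.1 (= arXiv:2112.05500 Lemma 2.1, chunk p0004:L39–L48)] -/
theorem prolate_sq_integrableOn_Iio (hlam : 0 < lam) (z : ℂ) {g g' : ℝ → ℂ}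
    (hg : ∀ x ∈ Iio (-lam), HasDerivAt g (g' x) x)
    (hu : ∀ x ∈ Iio (-lam), HasDerivAt (fun y ↦ pCoeff lam y * g' y) ((qCoeff lam x - z) * g x) x)
    {x₁ : ℝ} (hx₁ : x₁ < -lam) : IntegrableOn (fun x ↦ ‖g x‖ ^ 2) (Iio x₁) := by
  obtain ⟨hgt_d, hut⟩ := reflect_sol lam z hg hu
  have hI := prolate_sq_integrableOn_Ioi hlam z hgt_d hut (x₁ := -x₁) (by linarith)
  -- change of variables `x ↦ −x`
  have hmp : MeasurePreserving (Neg.neg : ℝ → ℝ) volume volume := Measure.measurePreserving_neg volume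
  have hemb : MeasurableEmbedding (Neg.neg : ℝ → ℝ) := (Homeomorph.neg ℝ).measurableEmbedding
  have hpre : (Neg.neg : ℝ → ℝ) ⁻¹' (Ioi (-x₁)) = Iio x₁ := by
    ext x; simp only [mem_preimage, mem_Ioi, mem_Iio]; constructor <;> intro h <;> linarith
  have h := (hmp.integrableOn_comp_preimage hemb (f := fun x ↦ ‖g (-x)‖ ^ 2) (s := Ioi (-x₁))).2 hI
  rw [hpre] at h
  refine h.congr_fun (fun x _ ↦ ?_) measurableSet_Iio
  simp only [Function.comp, neg_neg]

end AtBot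

/-! ## §6 The prolate equation at `λ⁺` and `(−λ)⁻`: non-degeneracy of the limit functional -/

section ProlateEndpoints

variable {lam : ℝ}

/-- The coefficient bounds of the prolate equation on `(λ, λ+1)`: `‖p(x)‖ ≥ 2λ(x − λ)` and
`‖q(x) − z‖ ≤ (2πλ)²(λ+1)² + ‖z‖`. [cite: ConnesMoscovici2022, §1 eq. (1.1) (= arXiv (2.1), chunk p0004:L5–L9)] -/
private theorem prolate_coeff_bounds_right (hlam : 0 < lam) (z : ℂ) {x : ℝ} (hx : x ∈ Ioo lam (lam + 1)) :
    2 * lam * (x - lam) ≤ ‖pCoeff lam x‖ ∧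
      ‖qCoeff lam x - z‖ ≤ (2 * π * lam) ^ 2 * (lam + 1) ^ 2 + ‖z‖ := by
  obtain ⟨hp, -⟩ := norm_pCoeff_of_lt hlam hx.1
  refine ⟨by rw [hp]; nlinarith [hx.1, hx.2], ?_⟩
  have hq : ‖qCoeff lam x‖ = (2 * π * lam) ^ 2 * x ^ 2 := by
    rw [qCoeff, Complex.norm_real, Real.norm_eq_abs, abs_of_nonneg (by positivity)]
  have hx2 : x ^ 2 ≤ (lam + 1) ^ 2 := by nlinarith [hx.1, hx.2]
  calc ‖qCoeff lam x - z‖ ≤ ‖qCoeff lam x‖ + ‖z‖ := norm_sub_le _ _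
    _ ≤ (2 * π * lam) ^ 2 * (lam + 1) ^ 2 + ‖z‖ := by
        rw [hq]; gcongr

/-- The coefficient bounds on `(−λ−1, −λ)`: `‖p(x)‖ ≥ 2λ(−λ − x)` and `‖q(x) − z‖ ≤ (2πλ)²(λ+1)² + ‖z‖`.
[cite: ConnesMoscovici2022, §1 eq. (1.1) (= arXiv (2.1), chunk p0004:L5–L9)] -/
private theorem prolate_coeff_bounds_left (hlam : 0 < lam) (z : ℂ) {x : ℝ}
    (hx : x ∈ Ioo (-lam - 1) (-lam)) :
    2 * lam * (-lam - x) ≤ ‖pCoeff lam x‖ ∧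
      ‖qCoeff lam x - z‖ ≤ (2 * π * lam) ^ 2 * (lam + 1) ^ 2 + ‖z‖ := by
  have hpe : pCoeff lam x = pCoeff lam (-x) := by simp [pCoeff]
  have hqe : qCoeff lam x = qCoeff lam (-x) := by simp [qCoeff]
  have hx' : -x ∈ Ioo lam (lam + 1) := ⟨by linarith [hx.2], by linarith [hx.1]⟩
  obtain ⟨h1, h2⟩ := prolate_coeff_bounds_right hlam z hx'
  rw [hpe, hqe]
  exact ⟨by linarith, h2⟩

/-- **The prolate equation at `λ⁺`** (`singularEndpoint_right` with `m = 2λ` on `(λ, λ+1)`): for a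
classical solution pair of `((λ² − x²) g′)′ = ((2πλx)² − z) g` on `(λ, ∞)`, the logarithmic coefficient
`lim_{x→λ⁺} (λ² − x²) g′(x)` exists, `(x − λ) g → 0`, and `g ∈ L²(λ, λ+1)`.
[cite: ConnesMoscovici2022, Lemma 1.1 (= arXiv:2112.05500 Lemma 2.1, chunk p0004:L39–L48)] -/
theorem prolate_singularEndpoint_right (hlam : 0 < lam) (z : ℂ) {g g' : ℝ → ℂ}
    (hg : ∀ x ∈ Ioi lam, HasDerivAt g (g' x) x)
    (hu : ∀ x ∈ Ioi lam, HasDerivAt (fun y ↦ pCoeff lam y * g' y) ((qCoeff lam x - z) * g x) x) :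
    (∃ c : ℂ, Tendsto (fun x ↦ pCoeff lam x * g' x) (𝓝[>] lam) (𝓝 c)) ∧
      Tendsto (fun x ↦ ((x - lam : ℝ) : ℂ) * g x) (𝓝[>] lam) (𝓝 0) ∧
      IntegrableOn (fun x ↦ ‖g x‖ ^ 2) (Ioo lam (lam + 1)) :=
  singularEndpoint_right (P := pCoeff lam) (r := fun x ↦ qCoeff lam x - z)
    (Q := (2 * π * lam) ^ 2 * (lam + 1) ^ 2 + ‖z‖) (by linarith) (by positivity : 0 < 2 * lam)
    (fun x hx ↦ hg x hx.1) (fun x hx ↦ hu x hx.1)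
    (((continuous_ofReal.comp (by fun_prop : Continuous fun x : ℝ ↦ (2 * π * lam) ^ 2 * x ^ 2)).continuousOn.congr
      (fun x _ ↦ by simp [qCoeff])).sub continuousOn_const)
    (fun x hx ↦ (prolate_coeff_bounds_right hlam z hx).2)
    (fun x hx ↦ (prolate_coeff_bounds_right hlam z hx).1)

/-- **The prolate equation at `(−λ)⁻`** (`singularEndpoint_left` with `m = 2λ` on `(−λ−1, −λ)`).
[cite: ConnesMoscovici2022, Lemma 1.1 (= arXiv:2112.05500 Lemma 2.1, chunk p0004:L39–L48)] -/
theorem prolate_singularEndpoint_left (hlam : 0 < lam) (z : ℂ) {g g' : ℝ → ℂ}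
    (hg : ∀ x ∈ Iio (-lam), HasDerivAt g (g' x) x)
    (hu : ∀ x ∈ Iio (-lam), HasDerivAt (fun y ↦ pCoeff lam y * g' y) ((qCoeff lam x - z) * g x) x) :
    (∃ c : ℂ, Tendsto (fun x ↦ pCoeff lam x * g' x) (𝓝[<] (-lam)) (𝓝 c)) ∧
      Tendsto (fun x ↦ ((-lam - x : ℝ) : ℂ) * g x) (𝓝[<] (-lam)) (𝓝 0) ∧
      IntegrableOn (fun x ↦ ‖g x‖ ^ 2) (Ioo (-lam - 1) (-lam)) :=
  singularEndpoint_left (P := pCoeff lam) (r := fun x ↦ qCoeff lam x - z)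
    (Q := (2 * π * lam) ^ 2 * (lam + 1) ^ 2 + ‖z‖) (by linarith) (by positivity : 0 < 2 * lam)
    (fun x hx ↦ hg x hx.2) (fun x hx ↦ hu x hx.2)
    (((continuous_ofReal.comp (by fun_prop : Continuous fun x : ℝ ↦ (2 * π * lam) ^ 2 * x ^ 2)).continuousOn.congr
      (fun x _ ↦ by simp [qCoeff])).sub continuousOn_const)
    (fun x hx ↦ (prolate_coeff_bounds_left hlam z hx).2)
    (fun x hx ↦ (prolate_coeff_bounds_left hlam z hx).1)

/-- **Non-degeneracy of the limit functional at `λ⁺`**: on `(λ, ∞)` there is a classical solution pair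
of `((λ² − x²) g′)′ = ((2πλx)² − z) g` whose logarithmic coefficient `lim_{x→λ⁺} (λ² − x²) g′(x)` is
NON-ZERO.  (Two solutions with Wronskian `1` at `x₀ = λ + 1/2` exist by
`UVProlateDeficiencyODE.exists_sol_Ioi`; if both coefficients vanished, the Wronskian would tend to `0`
at `λ⁺` by `wronskian_tendsto_zero_of_tendsto_zero`, contradicting its constancy `wronskian_sol_eq`.)
This is the input "the logarithmic singularities … have to match … reduces the number of parameters
to `4`" uses: each matching condition is a non-trivial linear condition.
[cite: ConnesMoscovici2022, Lemma 1.1 (= arXiv:2112.05500 Lemma 2.1, chunk p0004:L39–L48)] -/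
theorem exists_sol_Ioi_tendsto_ne_zero (hlam : 0 < lam) (z : ℂ) :
    ∃ g g' : ℝ → ℂ, (∀ x ∈ Ioi lam, HasDerivAt g (g' x) x ∧
        HasDerivAt (fun y ↦ pCoeff lam y * g' y) ((qCoeff lam x - z) * g x) x) ∧
      ∃ c : ℂ, c ≠ 0 ∧ Tendsto (fun x ↦ pCoeff lam x * g' x) (𝓝[>] lam) (𝓝 c) := by
  have hx₀ : lam < lam + 1 / 2 := by linarith
  obtain ⟨g₁, g₁', h10, h11, hs₁⟩ := exists_sol_Ioi hlam z hx₀ 1 0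
  obtain ⟨g₂, g₂', h20, h21, hs₂⟩ := exists_sol_Ioi hlam z hx₀ 0 1
  obtain ⟨⟨c₁, hc₁⟩, -, -⟩ := prolate_singularEndpoint_right hlam z (fun x hx ↦ (hs₁ x hx).1)
    (fun x hx ↦ (hs₁ x hx).2)
  obtain ⟨⟨c₂, hc₂⟩, -, -⟩ := prolate_singularEndpoint_right hlam z (fun x hx ↦ (hs₂ x hx).1)
    (fun x hx ↦ (hs₂ x hx).2)
  by_cases h1 : c₁ ≠ 0
  · exact ⟨g₁, g₁', hs₁, c₁, h1, hc₁⟩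
  by_cases h2 : c₂ ≠ 0
  · exact ⟨g₂, g₂', hs₂, c₂, h2, hc₂⟩
  exfalso
  push Not at h1 h2
  subst h1; subst h2
  -- both coefficients vanish: the Wronskian tends to `0` at `λ⁺` …
  have hW0 := wronskian_tendsto_zero_of_tendsto_zero (P := pCoeff lam) (r := fun x ↦ qCoeff lam x - z)
    (Q := (2 * π * lam) ^ 2 * (lam + 1) ^ 2 + ‖z‖) (a := lam) (b := lam + 1) (by linarith)
    (by positivity : 0 < 2 * lam)
    (fun x hx ↦ (hs₁ x hx.1).1) (fun x hx ↦ (hs₁ x hx.1).2)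
    (fun x hx ↦ (hs₂ x hx.1).1) (fun x hx ↦ (hs₂ x hx.1).2)
    (((continuous_ofReal.comp (by fun_prop : Continuous fun x : ℝ ↦ (2 * π * lam) ^ 2 * x ^ 2)).continuousOn.congr
      (fun x _ ↦ by simp [qCoeff])).sub continuousOn_const)
    (fun x hx ↦ (prolate_coeff_bounds_right hlam z hx).2)
    ((continuous_ofReal.comp (by fun_prop : Continuous fun x : ℝ ↦ lam ^ 2 - x ^ 2)).continuousOn.congr
      (fun x _ ↦ by simp [pCoeff]))
    (fun x hx ↦ (prolate_coeff_bounds_right hlam z hx).1) hc₁ hc₂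
  -- … but it is constant `= 1` on `(λ, λ+1)`
  have hW1 : ∀ x ∈ Ioo lam (lam + 1),
      g₁ x * (pCoeff lam x * g₂' x) - g₂ x * (pCoeff lam x * g₁' x) = 1 := by
    intro x hx
    have hx₀m : lam + 1 / 2 ∈ Ioo lam (lam + 1) := ⟨by linarith, by linarith⟩
    rw [wronskian_sol_eq (fun x hx ↦ (hs₁ x hx.1).1) (fun x hx ↦ (hs₁ x hx.1).2)
      (fun x hx ↦ (hs₂ x hx.1).1) (fun x hx ↦ (hs₂ x hx.1).2) hx hx₀m, h10, h21, h20, h11]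
    ring
  have hW1' : Tendsto (fun x ↦ g₁ x * (pCoeff lam x * g₂' x) - g₂ x * (pCoeff lam x * g₁' x))
      (𝓝[>] lam) (𝓝 1) :=
    tendsto_const_nhds.congr' (by
      filter_upwards [Ioo_mem_nhdsGT (show lam < lam + 1 by linarith)] with x hx using (hW1 x hx).symm)
  exact one_ne_zero (tendsto_nhds_unique hW1' hW0)

/-- **Non-degeneracy of the limit functional at `(−λ)⁻`**: on `(−∞, −λ)` there is a classical solution
pair whose logarithmic coefficient `lim_{x→(−λ)⁻} (λ² − x²) g′(x)` is non-zero.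
[cite: ConnesMoscovici2022, Lemma 1.1 (= arXiv:2112.05500 Lemma 2.1, chunk p0004:L39–L48)] -/
theorem exists_sol_Iio_tendsto_ne_zero (hlam : 0 < lam) (z : ℂ) :
    ∃ g g' : ℝ → ℂ, (∀ x ∈ Iio (-lam), HasDerivAt g (g' x) x ∧
        HasDerivAt (fun y ↦ pCoeff lam y * g' y) ((qCoeff lam x - z) * g x) x) ∧
      ∃ c : ℂ, c ≠ 0 ∧ Tendsto (fun x ↦ pCoeff lam x * g' x) (𝓝[<] (-lam)) (𝓝 c) := by
  have hx₀ : -lam - 1 / 2 < -lam := by linarith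
  obtain ⟨g₁, g₁', h10, h11, hs₁⟩ := exists_sol_Iio hlam z hx₀ 1 0
  obtain ⟨g₂, g₂', h20, h21, hs₂⟩ := exists_sol_Iio hlam z hx₀ 0 1
  obtain ⟨⟨c₁, hc₁⟩, -, -⟩ := prolate_singularEndpoint_left hlam z (fun x hx ↦ (hs₁ x hx).1)
    (fun x hx ↦ (hs₁ x hx).2)
  obtain ⟨⟨c₂, hc₂⟩, -, -⟩ := prolate_singularEndpoint_left hlam z (fun x hx ↦ (hs₂ x hx).1)
    (fun x hx ↦ (hs₂ x hx).2)
  by_cases h1 : c₁ ≠ 0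
  · exact ⟨g₁, g₁', hs₁, c₁, h1, hc₁⟩
  by_cases h2 : c₂ ≠ 0
  · exact ⟨g₂, g₂', hs₂, c₂, h2, hc₂⟩
  exfalso
  push Not at h1 h2
  subst h1; subst h2
  have hW0 := wronskian_tendsto_zero_of_tendsto_zero_left (P := pCoeff lam)
    (r := fun x ↦ qCoeff lam x - z) (Q := (2 * π * lam) ^ 2 * (lam + 1) ^ 2 + ‖z‖)
    (a := -lam - 1) (b := -lam) (by linarith) (by positivity : 0 < 2 * lam)
    (fun x hx ↦ (hs₁ x hx.2).1) (fun x hx ↦ (hs₁ x hx.2).2)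
    (fun x hx ↦ (hs₂ x hx.2).1) (fun x hx ↦ (hs₂ x hx.2).2)
    (((continuous_ofReal.comp (by fun_prop : Continuous fun x : ℝ ↦ (2 * π * lam) ^ 2 * x ^ 2)).continuousOn.congr
      (fun x _ ↦ by simp [qCoeff])).sub continuousOn_const)
    (fun x hx ↦ (prolate_coeff_bounds_left hlam z hx).2)
    ((continuous_ofReal.comp (by fun_prop : Continuous fun x : ℝ ↦ lam ^ 2 - x ^ 2)).continuousOn.congr
      (fun x _ ↦ by simp [pCoeff]))
    (fun x hx ↦ (prolate_coeff_bounds_left hlam z hx).1) hc₁ hc₂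
  have hW1 : ∀ x ∈ Ioo (-lam - 1) (-lam),
      g₁ x * (pCoeff lam x * g₂' x) - g₂ x * (pCoeff lam x * g₁' x) = 1 := by
    intro x hx
    have hx₀m : -lam - 1 / 2 ∈ Ioo (-lam - 1) (-lam) := ⟨by linarith, by linarith⟩
    rw [wronskian_sol_eq (fun x hx ↦ (hs₁ x hx.2).1) (fun x hx ↦ (hs₁ x hx.2).2)
      (fun x hx ↦ (hs₂ x hx.2).1) (fun x hx ↦ (hs₂ x hx.2).2) hx hx₀m, h10, h21, h20, h11]
    ring
  have hW1' : Tendsto (fun x ↦ g₁ x * (pCoeff lam x * g₂' x) - g₂ x * (pCoeff lam x * g₁' x))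
      (𝓝[<] (-lam)) (𝓝 1) :=
    tendsto_const_nhds.congr' (by
      filter_upwards [Ioo_mem_nhdsLT (show -lam - 1 < -lam by linarith)] with x hx
        using (hW1 x hx).symm)
  exact one_ne_zero (tendsto_nhds_unique hW1' hW0)

end ProlateEndpoints

/-! ## §7 The middle component `(−λ, λ)` at `λ⁻` and `(−λ)⁺` -/

section Middle

variable {lam : ℝ}

/-- For `|x| < λ`: `‖p(x)‖ = λ² − x²`. [cite: ConnesMoscovici2022, §1 eq. (1.1) (= arXiv (2.1), chunk p0004:L5–L9)] -/
private theorem norm_pCoeff_of_mem_Ioo {x : ℝ} (hx : x ∈ Ioo (-lam) lam) :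
    ‖pCoeff lam x‖ = lam ^ 2 - x ^ 2 := by
  have hlt : x ^ 2 < lam ^ 2 := by nlinarith [hx.1, hx.2]
  rw [pCoeff, Complex.norm_real, Real.norm_eq_abs, abs_of_nonneg (by linarith)]

/-- Coefficient bound on the middle component: `‖q(x) − z‖ ≤ (2πλ)²λ² + ‖z‖` for `|x| < λ`.
[cite: ConnesMoscovici2022, §1 eq. (1.1) (= arXiv (2.1), chunk p0004:L5–L9)] -/
private theorem prolate_q_bound_mid (lam : ℝ) (z : ℂ) {x : ℝ} (hx : x ∈ Ioo (-lam) lam) :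
    ‖qCoeff lam x - z‖ ≤ (2 * π * lam) ^ 2 * lam ^ 2 + ‖z‖ := by
  have hq : ‖qCoeff lam x‖ = (2 * π * lam) ^ 2 * x ^ 2 := by
    rw [qCoeff, Complex.norm_real, Real.norm_eq_abs, abs_of_nonneg (by positivity)]
  have hx2 : x ^ 2 ≤ lam ^ 2 := by nlinarith [hx.1, hx.2]
  calc ‖qCoeff lam x - z‖ ≤ ‖qCoeff lam x‖ + ‖z‖ := norm_sub_le _ _
    _ ≤ (2 * π * lam) ^ 2 * lam ^ 2 + ‖z‖ := by rw [hq]; gcongr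

/-- `‖p(x)‖ ≥ λ(λ − x)` on `(0, λ)`. [cite: ConnesMoscovici2022, §1 eq. (1.1) (= arXiv (2.1), chunk p0004:L5–L9)] -/
private theorem prolate_p_bound_mid_right {x : ℝ} (hx : x ∈ Ioo 0 lam) :
    lam * (lam - x) ≤ ‖pCoeff lam x‖ := by
  rw [norm_pCoeff_of_mem_Ioo ⟨by linarith [hx.1, hx.2], hx.2⟩]
  nlinarith [hx.1, hx.2]

/-- `‖p(x)‖ ≥ λ(x + λ)` on `(−λ, 0)`. [cite: ConnesMoscovici2022, §1 eq. (1.1) (= arXiv (2.1), chunk p0004:L5–L9)] -/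
private theorem prolate_p_bound_mid_left {x : ℝ} (hx : x ∈ Ioo (-lam) 0) :
    lam * (x - -lam) ≤ ‖pCoeff lam x‖ := by
  rw [norm_pCoeff_of_mem_Ioo ⟨hx.1, by linarith [hx.1, hx.2]⟩]
  nlinarith [hx.1, hx.2]

/-- Continuity of `q − z` and `p` (as maps `ℝ → ℂ`). [cite: ConnesMoscovici2022, §1 eq. (1.1) (= arXiv (2.1), chunk p0004:L5–L9)] -/
private theorem continuousOn_q_sub_p (lam : ℝ) (z : ℂ) (s : Set ℝ) :
    ContinuousOn (fun x ↦ qCoeff lam x - z) s ∧ ContinuousOn (pCoeff lam) s :=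
  ⟨((continuous_qCoeff_def lam).continuousOn).sub continuousOn_const,
    (continuous_pCoeff_def lam).continuousOn⟩

/-- **The middle component at `λ⁻`** (`singularEndpoint_left` with `m = λ` on `(0, λ)`): for a classical
solution pair on `(−λ, λ)`, `lim_{x→λ⁻} (λ² − x²) g′(x)` exists, `(λ − x) g → 0` at `λ⁻`, and
`g ∈ L²(0, λ)`. [cite: ConnesMoscovici2022, Lemma 1.1 (= arXiv:2112.05500 Lemma 2.1, chunk p0004:L39–L48)] -/
theorem prolate_singularEndpoint_mid_right (hlam : 0 < lam) (z : ℂ) {g g' : ℝ → ℂ}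
    (hg : ∀ x ∈ Ioo (-lam) lam, HasDerivAt g (g' x) x)
    (hu : ∀ x ∈ Ioo (-lam) lam, HasDerivAt (fun y ↦ pCoeff lam y * g' y) ((qCoeff lam x - z) * g x) x) :
    (∃ c : ℂ, Tendsto (fun x ↦ pCoeff lam x * g' x) (𝓝[<] lam) (𝓝 c)) ∧
      Tendsto (fun x ↦ ((lam - x : ℝ) : ℂ) * g x) (𝓝[<] lam) (𝓝 0) ∧
      IntegrableOn (fun x ↦ ‖g x‖ ^ 2) (Ioo 0 lam) := by
  have hsub : Ioo 0 lam ⊆ Ioo (-lam) lam := fun x hx ↦ ⟨by linarith [hx.1], hx.2⟩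
  exact singularEndpoint_left (P := pCoeff lam) (r := fun x ↦ qCoeff lam x - z)
    (Q := (2 * π * lam) ^ 2 * lam ^ 2 + ‖z‖) hlam hlam
    (fun x hx ↦ hg x (hsub hx)) (fun x hx ↦ hu x (hsub hx))
    (continuousOn_q_sub_p lam z _).1
    (fun x hx ↦ prolate_q_bound_mid lam z (hsub hx))
    (fun x hx ↦ prolate_p_bound_mid_right hx)

/-- **The middle component at `(−λ)⁺`** (`singularEndpoint_right` with `m = λ` on `(−λ, 0)`).
[cite: ConnesMoscovici2022, Lemma 1.1 (= arXiv:2112.05500 Lemma 2.1, chunk p0004:L39–L48)] -/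
theorem prolate_singularEndpoint_mid_left (hlam : 0 < lam) (z : ℂ) {g g' : ℝ → ℂ}
    (hg : ∀ x ∈ Ioo (-lam) lam, HasDerivAt g (g' x) x)
    (hu : ∀ x ∈ Ioo (-lam) lam, HasDerivAt (fun y ↦ pCoeff lam y * g' y) ((qCoeff lam x - z) * g x) x) :
    (∃ c : ℂ, Tendsto (fun x ↦ pCoeff lam x * g' x) (𝓝[>] (-lam)) (𝓝 c)) ∧
      Tendsto (fun x ↦ ((x - -lam : ℝ) : ℂ) * g x) (𝓝[>] (-lam)) (𝓝 0) ∧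
      IntegrableOn (fun x ↦ ‖g x‖ ^ 2) (Ioo (-lam) 0) := by
  have hsub : Ioo (-lam) 0 ⊆ Ioo (-lam) lam := fun x hx ↦ ⟨hx.1, by linarith [hx.2]⟩
  exact singularEndpoint_right (P := pCoeff lam) (r := fun x ↦ qCoeff lam x - z)
    (Q := (2 * π * lam) ^ 2 * lam ^ 2 + ‖z‖) (by linarith) hlam
    (fun x hx ↦ hg x (hsub hx)) (fun x hx ↦ hu x (hsub hx))
    (continuousOn_q_sub_p lam z _).1
    (fun x hx ↦ prolate_q_bound_mid lam z (hsub hx))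
    (fun x hx ↦ prolate_p_bound_mid_left hx)

/-- **`g ∈ L²(−λ, λ)`** for every classical solution pair on the middle component (both endpoints are
limit-circle). [cite: ConnesMoscovici2022, Lemma 1.1 (= arXiv:2112.05500 Lemma 2.1, chunk p0004:L39–L48)] -/
theorem prolate_sq_integrableOn_mid (hlam : 0 < lam) (z : ℂ) {g g' : ℝ → ℂ}
    (hg : ∀ x ∈ Ioo (-lam) lam, HasDerivAt g (g' x) x)
    (hu : ∀ x ∈ Ioo (-lam) lam, HasDerivAt (fun y ↦ pCoeff lam y * g' y) ((qCoeff lam x - z) * g x) x) :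
    IntegrableOn (fun x ↦ ‖g x‖ ^ 2) (Ioo (-lam) lam) := by
  obtain ⟨-, -, h1⟩ := prolate_singularEndpoint_mid_left hlam z hg hu
  obtain ⟨-, -, h2⟩ := prolate_singularEndpoint_mid_right hlam z hg hu
  have h2' : IntegrableOn (fun x ↦ ‖g x‖ ^ 2) (Ico 0 lam) :=
    (integrableOn_Ico_iff_integrableOn_Ioo (by simp)).2 h2
  have h := h1.union h2'
  rwa [Ioo_union_Ico_eq_Ioo (by linarith) hlam.le] at h

/-- **Non-degeneracy of the limit functional at `λ⁻` (middle component)**: on `(−λ, λ)` there is a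
classical solution pair with `lim_{x→λ⁻} (λ² − x²) g′(x) ≠ 0`.
[cite: ConnesMoscovici2022, Lemma 1.1 (= arXiv:2112.05500 Lemma 2.1, chunk p0004:L39–L48)] -/
theorem exists_sol_Ioo_tendsto_ne_zero_right (hlam : 0 < lam) (z : ℂ) :
    ∃ g g' : ℝ → ℂ, (∀ x ∈ Ioo (-lam) lam, HasDerivAt g (g' x) x ∧
        HasDerivAt (fun y ↦ pCoeff lam y * g' y) ((qCoeff lam x - z) * g x) x) ∧
      ∃ c : ℂ, c ≠ 0 ∧ Tendsto (fun x ↦ pCoeff lam x * g' x) (𝓝[<] lam) (𝓝 c) := by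
  have hx₀ : lam / 2 ∈ Ioo (-lam) lam := ⟨by linarith, by linarith⟩
  obtain ⟨g₁, g₁', h10, h11, hs₁⟩ := exists_sol_Ioo z hx₀ 1 0
  obtain ⟨g₂, g₂', h20, h21, hs₂⟩ := exists_sol_Ioo z hx₀ 0 1
  obtain ⟨⟨c₁, hc₁⟩, -, -⟩ := prolate_singularEndpoint_mid_right hlam z (fun x hx ↦ (hs₁ x hx).1)
    (fun x hx ↦ (hs₁ x hx).2)
  obtain ⟨⟨c₂, hc₂⟩, -, -⟩ := prolate_singularEndpoint_mid_right hlam z (fun x hx ↦ (hs₂ x hx).1)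
    (fun x hx ↦ (hs₂ x hx).2)
  by_cases h1 : c₁ ≠ 0
  · exact ⟨g₁, g₁', hs₁, c₁, h1, hc₁⟩
  by_cases h2 : c₂ ≠ 0
  · exact ⟨g₂, g₂', hs₂, c₂, h2, hc₂⟩
  exfalso
  push Not at h1 h2
  subst h1; subst h2
  have hsub : Ioo 0 lam ⊆ Ioo (-lam) lam := fun x hx ↦ ⟨by linarith [hx.1], hx.2⟩
  have hW0 := wronskian_tendsto_zero_of_tendsto_zero_left (P := pCoeff lam)
    (r := fun x ↦ qCoeff lam x - z) (Q := (2 * π * lam) ^ 2 * lam ^ 2 + ‖z‖)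
    (a := 0) (b := lam) hlam hlam
    (fun x hx ↦ (hs₁ x (hsub hx)).1) (fun x hx ↦ (hs₁ x (hsub hx)).2)
    (fun x hx ↦ (hs₂ x (hsub hx)).1) (fun x hx ↦ (hs₂ x (hsub hx)).2)
    (continuousOn_q_sub_p lam z _).1
    (fun x hx ↦ prolate_q_bound_mid lam z (hsub hx))
    (continuousOn_q_sub_p lam z _).2
    (fun x hx ↦ prolate_p_bound_mid_right hx) hc₁ hc₂
  have hW1 : ∀ x ∈ Ioo 0 lam,
      g₁ x * (pCoeff lam x * g₂' x) - g₂ x * (pCoeff lam x * g₁' x) = 1 := by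
    intro x hx
    have hx₀m : lam / 2 ∈ Ioo 0 lam := ⟨by linarith, by linarith⟩
    rw [wronskian_sol_eq (fun x hx ↦ (hs₁ x (hsub hx)).1) (fun x hx ↦ (hs₁ x (hsub hx)).2)
      (fun x hx ↦ (hs₂ x (hsub hx)).1) (fun x hx ↦ (hs₂ x (hsub hx)).2) hx hx₀m, h10, h21, h20, h11]
    ring
  have hW1' : Tendsto (fun x ↦ g₁ x * (pCoeff lam x * g₂' x) - g₂ x * (pCoeff lam x * g₁' x))
      (𝓝[<] lam) (𝓝 1) :=
    tendsto_const_nhds.congr' (by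
      filter_upwards [Ioo_mem_nhdsLT hlam] with x hx using (hW1 x hx).symm)
  exact one_ne_zero (tendsto_nhds_unique hW1' hW0)

/-- **Non-degeneracy of the limit functional at `(−λ)⁺` (middle component)**.
[cite: ConnesMoscovici2022, Lemma 1.1 (= arXiv:2112.05500 Lemma 2.1, chunk p0004:L39–L48)] -/
theorem exists_sol_Ioo_tendsto_ne_zero_left (hlam : 0 < lam) (z : ℂ) :
    ∃ g g' : ℝ → ℂ, (∀ x ∈ Ioo (-lam) lam, HasDerivAt g (g' x) x ∧
        HasDerivAt (fun y ↦ pCoeff lam y * g' y) ((qCoeff lam x - z) * g x) x) ∧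
      ∃ c : ℂ, c ≠ 0 ∧ Tendsto (fun x ↦ pCoeff lam x * g' x) (𝓝[>] (-lam)) (𝓝 c) := by
  have hx₀ : -lam / 2 ∈ Ioo (-lam) lam := ⟨by linarith, by linarith⟩
  obtain ⟨g₁, g₁', h10, h11, hs₁⟩ := exists_sol_Ioo z hx₀ 1 0
  obtain ⟨g₂, g₂', h20, h21, hs₂⟩ := exists_sol_Ioo z hx₀ 0 1
  obtain ⟨⟨c₁, hc₁⟩, -, -⟩ := prolate_singularEndpoint_mid_left hlam z (fun x hx ↦ (hs₁ x hx).1)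
    (fun x hx ↦ (hs₁ x hx).2)
  obtain ⟨⟨c₂, hc₂⟩, -, -⟩ := prolate_singularEndpoint_mid_left hlam z (fun x hx ↦ (hs₂ x hx).1)
    (fun x hx ↦ (hs₂ x hx).2)
  by_cases h1 : c₁ ≠ 0
  · exact ⟨g₁, g₁', hs₁, c₁, h1, hc₁⟩
  by_cases h2 : c₂ ≠ 0
  · exact ⟨g₂, g₂', hs₂, c₂, h2, hc₂⟩
  exfalso
  push Not at h1 h2
  subst h1; subst h2
  have hsub : Ioo (-lam) 0 ⊆ Ioo (-lam) lam := fun x hx ↦ ⟨hx.1, by linarith [hx.2]⟩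
  have hW0 := wronskian_tendsto_zero_of_tendsto_zero (P := pCoeff lam)
    (r := fun x ↦ qCoeff lam x - z) (Q := (2 * π * lam) ^ 2 * lam ^ 2 + ‖z‖)
    (a := -lam) (b := 0) (by linarith) hlam
    (fun x hx ↦ (hs₁ x (hsub hx)).1) (fun x hx ↦ (hs₁ x (hsub hx)).2)
    (fun x hx ↦ (hs₂ x (hsub hx)).1) (fun x hx ↦ (hs₂ x (hsub hx)).2)
    (continuousOn_q_sub_p lam z _).1
    (fun x hx ↦ prolate_q_bound_mid lam z (hsub hx))
    (continuousOn_q_sub_p lam z _).2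
    (fun x hx ↦ prolate_p_bound_mid_left hx) hc₁ hc₂
  have hW1 : ∀ x ∈ Ioo (-lam) 0,
      g₁ x * (pCoeff lam x * g₂' x) - g₂ x * (pCoeff lam x * g₁' x) = 1 := by
    intro x hx
    have hx₀m : -lam / 2 ∈ Ioo (-lam) 0 := ⟨by linarith, by linarith⟩
    rw [wronskian_sol_eq (fun x hx ↦ (hs₁ x (hsub hx)).1) (fun x hx ↦ (hs₁ x (hsub hx)).2)
      (fun x hx ↦ (hs₂ x (hsub hx)).1) (fun x hx ↦ (hs₂ x (hsub hx)).2) hx hx₀m, h10, h21, h20, h11]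
    ring
  have hW1' : Tendsto (fun x ↦ g₁ x * (pCoeff lam x * g₂' x) - g₂ x * (pCoeff lam x * g₁' x))
      (𝓝[>] (-lam)) (𝓝 1) :=
    tendsto_const_nhds.congr' (by
      filter_upwards [Ioo_mem_nhdsGT (show -lam < 0 by linarith)] with x hx using (hW1 x hx).symm)
  exact one_ne_zero (tendsto_nhds_unique hW1' hW0)

end Middle

/-! ## §8 Full components: `g ∈ L²(λ, ∞)` and `g ∈ L²(−∞, −λ)` -/

section FullComponents

variable {lam : ℝ}

/-- **Every classical solution pair on `(λ, ∞)` is square integrable there** (limit circle at `λ⁺`,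
`O(1/x)` decay at `+∞`): the `(λ, ∞)`-part of "any solution of `Wξ = ±iξ` belongs to `Dom(W_max)`".
[cite: ConnesMoscovici2022, Lemma 1.1 (= arXiv:2112.05500 Lemma 2.1, chunk p0004:L39–L48)] -/
theorem prolate_sq_integrableOn_Ioi_lam (hlam : 0 < lam) (z : ℂ) {g g' : ℝ → ℂ}
    (hg : ∀ x ∈ Ioi lam, HasDerivAt g (g' x) x)
    (hu : ∀ x ∈ Ioi lam, HasDerivAt (fun y ↦ pCoeff lam y * g' y) ((qCoeff lam x - z) * g x) x) :
    IntegrableOn (fun x ↦ ‖g x‖ ^ 2) (Ioi lam) := by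
  obtain ⟨-, -, h1⟩ := prolate_singularEndpoint_right hlam z hg hu
  have h2 := prolate_sq_integrableOn_Ioi hlam z hg hu (x₁ := lam + 1 / 2) (by linarith)
  have h := h1.union h2
  have e : Ioo lam (lam + 1) ∪ Ioi (lam + 1 / 2) = Ioi lam := by
    ext x; simp only [mem_union, mem_Ioo, mem_Ioi]
    constructor
    · rintro (⟨h, -⟩ | h) <;> linarith
    · intro h
      by_cases hx : x < lam + 1
      · exact Or.inl ⟨h, hx⟩
      · exact Or.inr (by linarith)
  rwa [e] at h

/-- **Every classical solution pair on `(−∞, −λ)` is square integrable there.**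
[cite: ConnesMoscovici2022, Lemma 1.1 (= arXiv:2112.05500 Lemma 2.1, chunk p0004:L39–L48)] -/
theorem prolate_sq_integrableOn_Iio_neg_lam (hlam : 0 < lam) (z : ℂ) {g g' : ℝ → ℂ}
    (hg : ∀ x ∈ Iio (-lam), HasDerivAt g (g' x) x)
    (hu : ∀ x ∈ Iio (-lam), HasDerivAt (fun y ↦ pCoeff lam y * g' y) ((qCoeff lam x - z) * g x) x) :
    IntegrableOn (fun x ↦ ‖g x‖ ^ 2) (Iio (-lam)) := by
  obtain ⟨-, -, h1⟩ := prolate_singularEndpoint_left hlam z hg hu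
  have h2 := prolate_sq_integrableOn_Iio hlam z hg hu (x₁ := -lam - 1 / 2) (by linarith)
  have h := h1.union h2
  have e : Ioo (-lam - 1) (-lam) ∪ Iio (-lam - 1 / 2) = Iio (-lam) := by
    ext x; simp only [mem_union, mem_Ioo, mem_Iio]
    constructor
    · rintro (⟨-, h⟩ | h) <;> linarith
    · intro h
      by_cases hx : -lam - 1 < x
      · exact Or.inl ⟨hx, h⟩
      · exact Or.inr (by linarith)
  rwa [e] at h

end FullComponents

end Literature.NumberTheory.ConnesMoscovici2022
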